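import Literature.Topology.FourManifolds.DomeSweep
import Literature.Topology.FourManifolds.AlignAssembly
import Literature.Topology.FourManifolds.SweepGlue
import Literature.Topology.FourManifolds.SweepTransfer
import Literature.Topology.FourManifolds.SubsphereMorse
import Literature.Topology.FourManifolds.SubsphereSide
import HarnessLib

/-!
# The sweep of the capped-ball step: absorbing the ball `B` through the lid

Topic `Literature/Topology/FourManifolds`; fact seat of Alexander's theorem
(`provefact-Literature.Topology.FourManifolds.SphereEmbedding.schoenflies_exists_ball`, Schultens
(2014), Thm. 3.2.5).  **Everything in this file is proved; no definitions, no named facts.**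

This is the absorption move of the inductive step of the printed proof (Schultens (2014), PDF
p. 45: "`S₁` … bounds a `3`-ball, so Lemma 3.2.3 applies and `S` is isotopic to `S₂`") on the
level of solids, in the normal form of the fact seat: the filled solid `A₁ = {F₂ ≤ 0}` contains
the ball `B = {F_B ≤ 0}` bounded by the smoothed sphere `W = S₁` (`CappedBallData`,
`SubsphereLevel`, `SubsphereParam`), `B` is known to be a ball (a diffeomorphism `Φ_B` of `ℝ³`
with `Φ_B(𝔻̄) = B`: the induction hypothesis), and the sweep lemma (`SweepTransfer.exists_sweep`)
pushes the free boundary of `B` up through `B` to the cutting bowl just above level `0`,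
producing a diffeomorphism `Φ` of `ℝ³` with `Φ(A₁) = U = {F_U ≤ 0}` whose boundary is the
sphere `S₂` smoothed "in a way that introduces only one new critical point".

* §1 values of the filled function in the lid box; the low part of `A₁` in the box lies in `B`;
* §2 `SweepDriver.exists_sweepStep` — **the absorption**: there are a smooth `F_U ≥ F₂`, regular on
  its zero set, and a diffeomorphism `Φ` with `Φ({F₂ ≤ 0}) = {F_U ≤ 0}`, `Φ({F₂ = 0}) = {F_U = 0}`,
  equal to the identity (and `F_U = F₂`) near every far boundary point (off the closed box and
  off `E₂`); the horizontal points of `F_U` on its zero set are the far ones of `F₂` off `E₂` and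
  the bowl centre `p_c = (0, 0, 3s/8)`, near which `F_U = (z_b - x₂)/s`; and the zero set of `F_U`
  meets the level `x₂ = 0` exactly in the far zeros of `F₂` off `E₂`.

The sweep function is `w = H ∘ Ψ⁻¹` near `B`, `H = w_std ∘ Φ_M` (`ModelSweep`), with `Ψ` the
aligned parametrisation of `B` (`AlignAssembly.exists_alignedParam`: `Ψ = Φ_M` on the zone
`y₂ ≥ s/32`), glued (`SweepGlue`) to the standard sweep function `w_std` (`SweepFace`, bowl
`z_b = 3s/8 + (s/8)ρ²`, `κ = s`) on the explicit region above height `-3s/8` outside the model.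

## References
* J. Schultens, *Introduction to 3-Manifolds*, GSM 151, AMS (2014), Lemma 3.2.3 and Thm. 3.2.5
  (PDF pp. 42–45).
-/

noncomputable section

open Set Metric Filter Topology Function
open scoped ContDiff RealInnerProductSpace Manifold

namespace Literature.Topology.FourManifolds.SweepDriver

open CappedBallLid SweepFace DomeModel

variable {F : EuclideanSpace ℝ (Fin 3) → ℝ} {P : ℝ → ℝ} {E₁ E₂ : Set (EuclideanSpace ℝ (Fin 3))}
  {w₀ η₀ ε₀ s δ : ℝ}

/-! ### §1 Values of the filled function in the lid box -/

section Values

variable (hP : Admissible P) (hN : StepNF F E₁ E₂ w₀ η₀ ε₀) (hS : StepScale s δ w₀ η₀)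
include hP hN hS

omit hP in
/-- In the lid box the defining function is `ρ² - 1`. [folklore] -/
theorem F_eq {x : EuclideanSpace ℝ (Fin 3)} (hx1 : hsq x ≤ (1 + 2 * s) ^ 2) (hx2 : |x 2| ≤ 3 * s) :
    F x = hsq x - 1 := by
  obtain ⟨hs, -, -, -, -, -⟩ := scales hS
  exact F_eq_of_box hN hS (by nlinarith) (by linarith [abs_nonneg (x 2)])

omit hP hN in
/-- In the lid box the filled function is the smooth minimum `F ⊓_δ G`. [folklore] -/
theorem fillFun_eq_smin {x : EuclideanSpace ℝ (Fin 3)} (hx1 : hsq x ≤ (1 + 2 * s) ^ 2)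
    (hx2 : -3 * s ≤ x 2) (hx3 : x 2 ≤ 2 * s) :
    fillFun F P s δ ((1 + s) ^ 2 + ε₀ + 2) x = F x - δ * P ((F x - lidFun P s x) / δ) := by
  obtain ⟨hs, -, -, -, -, -⟩ := scales hS
  unfold fillFun
  rw [fillWeight_eq_of_mem_box hs hx1 hx2 hx3]
  ring_nf

omit hN in
/-- In the lid box: `F ≤ G - δ` gives `F₂ = F`. [folklore] -/
theorem fillFun_eq_F {x : EuclideanSpace ℝ (Fin 3)} (hx1 : hsq x ≤ (1 + 2 * s) ^ 2)
    (hx2 : -3 * s ≤ x 2) (hx3 : x 2 ≤ 2 * s) (h : F x ≤ lidFun P s x - δ) :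
    fillFun F P s δ ((1 + s) ^ 2 + ε₀ + 2) x = F x := by
  obtain ⟨hs, -, -, -, hδ, -⟩ := scales hS
  apply fillFun_eq_left hP.hP0 hδ
  rw [fillWeight_eq_of_mem_box hs hx1 hx2 hx3]; linarith

omit hN in
/-- In the lid box: `G ≤ F - δ` gives `F₂ = G`. [folklore] -/
theorem fillFun_eq_lid {x : EuclideanSpace ℝ (Fin 3)} (hx1 : hsq x ≤ (1 + 2 * s) ^ 2)
    (hx2 : -3 * s ≤ x 2) (hx3 : x 2 ≤ 2 * s) (h : lidFun P s x ≤ F x - δ) :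
    fillFun F P s δ ((1 + s) ^ 2 + ε₀ + 2) x = lidFun P s x := by
  obtain ⟨hs, -, -, -, hδ, -⟩ := scales hS
  have := fillFun_eq_right hP.hP1 hδ (F := F) (s := s) (M := (1 + s) ^ 2 + ε₀ + 2) (x := x) (P := P)
    (by rw [fillWeight_eq_of_mem_box hs hx1 hx2 hx3]; linarith)
  rw [this, fillWeight_eq_of_mem_box hs hx1 hx2 hx3]; ring

omit hN in
/-- In the lid box: `min(F, G) - δ ≤ F₂ ≤ min(F, G)`. [folklore] -/
theorem fillFun_mem {x : EuclideanSpace ℝ (Fin 3)} (hx1 : hsq x ≤ (1 + 2 * s) ^ 2)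
    (hx2 : -3 * s ≤ x 2) (hx3 : x 2 ≤ 2 * s) :
    min (F x) (lidFun P s x) - δ ≤ fillFun F P s δ ((1 + s) ^ 2 + ε₀ + 2) x ∧
      fillFun F P s δ ((1 + s) ^ 2 + ε₀ + 2) x ≤ min (F x) (lidFun P s x) := by
  obtain ⟨hs, -, -, -, hδ, -⟩ := scales hS
  have h1 := fillFun_le_min hP.hPge hδ (F := F) (s := s) (M := (1 + s) ^ 2 + ε₀ + 2) x (P := P)
  have h2 := min_sub_le_fillFun hP.hPle hδ (F := F) (s := s) (M := (1 + s) ^ 2 + ε₀ + 2) x (P := P)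
  rw [fillWeight_eq_of_mem_box hs hx1 hx2 hx3] at h1 h2
  simp only [add_sub_cancel_left] at h1 h2
  exact ⟨h2, h1⟩

omit hN in
/-- **In the lid box, `G > 0` and `F > 2δ` force `F₂ > 0`.** [folklore] -/
theorem fillFun_pos {x : EuclideanSpace ℝ (Fin 3)} (hx1 : hsq x ≤ (1 + 2 * s) ^ 2)
    (hx2 : -3 * s ≤ x 2) (hx3 : x 2 ≤ 2 * s) (hG : 0 < lidFun P s x) (hF : 2 * δ < F x) :
    0 < fillFun F P s δ ((1 + s) ^ 2 + ε₀ + 2) x := by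
  obtain ⟨hs, -, -, -, hδ, -⟩ := scales hS
  by_cases h1 : F x ≤ lidFun P s x - δ
  · rw [fillFun_eq_F hP hS hx1 hx2 hx3 h1]; linarith
  by_cases h2 : lidFun P s x ≤ F x - δ
  · rw [fillFun_eq_lid hP hS hx1 hx2 hx3 h2]; exact hG
  · push Not at h1 h2
    have := (fillFun_mem hP hS (F := F) (ε₀ := ε₀) hx1 hx2 hx3).1
    have hmin : δ < min (F x) (lidFun P s x) := lt_min (by linarith) (by linarith)
    linarith

/-- **A point of the filled solid in the lid box at height `≤ -3s/8` lies in `B`.**  Otherwise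
`F_B > 0`, so `G > 0`, so `max(a, b) > -κ`; either branch forces `ρ²` so large that
`F = ρ² - 1 > 2δ`, and then `F₂ > 0`. [folklore] -/
theorem FB_nonpos_of_low {FB : EuclideanSpace ℝ (Fin 3) → ℝ} (hface : StdFace FB P s)
    {x : EuclideanSpace ℝ (Fin 3)} (hx1 : hsq x < (1 + 2 * s) ^ 2) (hx2 : -(5 * s / 2) < x 2)
    (hx3 : x 2 ≤ -(3 * s / 8)) (hA : fillFun F P s δ ((1 + s) ^ 2 + ε₀ + 2) x ≤ 0) : FB x ≤ 0 := by
  obtain ⟨hs, hs1, hsw, hsη, hδ, hδs⟩ := scales hS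
  by_contra hpos
  push Not at hpos
  have hLZ : x ∈ lidZone s := ⟨hx1, hx2, by linarith⟩
  have hG : 0 < lidFun P s x := (hface x hLZ).2.1 hpos
  have hF : F x = hsq x - 1 := F_eq hN hS hx1.le (abs_le.2 ⟨by linarith, by linarith⟩)
  have hle := lidFun_le_max_add hP.hPle hs x
  have hmax : -(s / 8) < max (topFun s x) (rimFun s x) := by linarith
  have hF2δ : 2 * δ < F x := by
    rw [hF]
    rcases lt_max_iff.1 hmax with ht | hr
    · unfold topFun at ht; nlinarith
    · unfold rimFun at hr
      have hrr := half_le_rimRadius hs (show -3 * s ≤ x 2 by linarith)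
      nlinarith
  have := fillFun_pos hP hS (ε₀ := ε₀) hx1.le (by linarith) (by linarith) hG hF2δ
  linarith

/-- **On the lateral cylinder `ρ² = (1 + 3s/2)²` of the face box the filled function is
positive.** [folklore] -/
theorem fillFun_pos_of_lateral {x : EuclideanSpace ℝ (Fin 3)} (hx1 : hsq x = (1 + 3 * s / 2) ^ 2)
    (hx2 : -3 * s ≤ x 2) (hx3 : x 2 ≤ 2 * s) : 0 < fillFun F P s δ ((1 + s) ^ 2 + ε₀ + 2) x := by
  obtain ⟨hs, hs1, hsw, hsη, hδ, hδs⟩ := scales hS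
  have hx1' : hsq x ≤ (1 + 2 * s) ^ 2 := by rw [hx1]; nlinarith
  have hF : F x = hsq x - 1 := F_eq hN hS hx1' (abs_le.2 ⟨by linarith, by linarith⟩)
  have hrim : 0 < rimFun s x := by
    unfold rimFun
    have h1 := rimRadius_le hs (x 2)
    have h2 := rimRadius_nonneg hs (x 2)
    rw [hx1]; nlinarith
  have hG : 0 < lidFun P s x := lt_of_lt_of_le hrim ((le_max_right _ _).trans (max_le_lidFun hP.hPge hs x))
  exact fillFun_pos hP hS hx1' hx2 hx3 hG (by rw [hF, hx1]; nlinarith)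

omit hN in
/-- **A zero of the lid function at height `≤ -3s/8` (and `≥ -3s`) lies on the rim side**:
`ρ² ≥ 1 + 3s/4`, so `F = ρ² - 1` exceeds `δ` with room to spare. [folklore] -/
theorem hsq_ge_of_lidFun_eq_zero {x : EuclideanSpace ℝ (Fin 3)} (hG : lidFun P s x = 0)
    (hz : x 2 ≤ -(3 * s / 8)) (hz' : -3 * s ≤ x 2) : 1 + 3 * s / 4 ≤ hsq x := by
  obtain ⟨hs, hs1, -, -, -, -⟩ := scales hS
  have hle := lidFun_le_max_add hP.hPle hs x
  rw [hG] at hle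
  have hge : -(s / 8) ≤ max (topFun s x) (rimFun s x) := by linarith
  rcases le_max_iff.1 hge with ht | hr
  · unfold topFun at ht; nlinarith
  · unfold rimFun at hr
    have hrr := half_le_rimRadius hs hz'
    nlinarith

/-- **A regular zero of the filled function is not a local maximum of it**: `F₂ ≤ 0` cannot hold
near a zero. [folklore] -/
theorem not_eventually_nonpos {x : EuclideanSpace ℝ (Fin 3)}
    (hx : fillFun F P s δ ((1 + s) ^ 2 + ε₀ + 2) x = 0)
    (hev : ∀ᶠ y in 𝓝 x, fillFun F P s δ ((1 + s) ^ 2 + ε₀ + 2) y ≤ 0) : False := by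
  obtain ⟨hs, hs1, hsw, hsη, hδ, hδs⟩ := scales hS
  have hreg := fderiv_fillFun_ne_zero hP.hP hP.hP0 hP.hPd hP.hPge hP.hPle hN.hF hN.hε₀ hN.hreg hs hs1 hsw
    (by linarith) hN.hNFa hN.hNFb hδ (by linarith) hx
  have hmax : IsLocalMax (fillFun F P s δ ((1 + s) ^ 2 + ε₀ + 2)) x := by
    filter_upwards [hev] with y hy; rw [hx]; exact hy
  exact hreg hmax.fderiv_eq_zero

omit hP in
/-- In the open lid box the defining function is `ρ² - 1` nearby, with derivative `dρ²`.
[folklore] -/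
theorem fderiv_F_eq_dhsq {x : EuclideanSpace ℝ (Fin 3)} (hx1 : hsq x < (1 + 2 * s) ^ 2) (hx2 : |x 2| < 3 * s) :
    (F =ᶠ[𝓝 x] fun y => hsq y - 1) ∧ fderiv ℝ F x = dhsq x := by
  obtain ⟨hs, -, -, -, -, -⟩ := scales hS
  have hev : F =ᶠ[𝓝 x] fun y => hsq y - 1 := by
    have hopen : IsOpen {y : EuclideanSpace ℝ (Fin 3) | hsq y < (1 + 2 * s) ^ 2 ∧ |y 2| < 3 * s} :=
      (isOpen_lt continuous_hsq continuous_const).inter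
        (isOpen_lt (continuous_abs.comp (continuous_coord 2)) continuous_const)
    filter_upwards [hopen.mem_nhds ⟨hx1, hx2⟩] with y hy
    exact F_eq hN hS hy.1.le hy.2.le
  refine ⟨hev, ?_⟩
  rw [hev.fderiv_eq]
  exact ((hasFDerivAt_hsq x).sub_const 1).fderiv

omit hP hN in
/-- In the open lid box the fill weight is `1 + G` nearby. [folklore] -/
theorem fillWeight_eventuallyEq {M : ℝ} {x : EuclideanSpace ℝ (Fin 3)} (hx1 : hsq x < (1 + 2 * s) ^ 2)
    (hx2 : -3 * s < x 2) (hx3 : x 2 < 2 * s) :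
    fillWeight P s δ M =ᶠ[𝓝 x] fun y => 1 + lidFun P s y := by
  obtain ⟨hs, -, -, -, -, -⟩ := scales hS
  have hopen : IsOpen {y : EuclideanSpace ℝ (Fin 3) | hsq y < (1 + 2 * s) ^ 2 ∧ -3 * s < y 2 ∧ y 2 < 2 * s} :=
    (isOpen_lt continuous_hsq continuous_const).inter
      ((isOpen_lt continuous_const (continuous_coord 2)).inter (isOpen_lt (continuous_coord 2) continuous_const))
  filter_upwards [hopen.mem_nhds ⟨hx1, hx2, hx3⟩] with y hy
  exact fillWeight_eq_of_mem_box hs hy.1.le hy.2.1.le hy.2.2.le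

/-- **The horizontal radial derivative of the filled function in the open lid box** is
`K ρ²` with `K ≥ 2s`: a convex combination of `2ρ²` (from `F = ρ² - 1`) and `μ ρ²`, `μ ≥ 2s`
(from the lid function). [folklore] -/
theorem fderiv_fillFun_horizontal {x : EuclideanSpace ℝ (Fin 3)} (hx1 : hsq x < (1 + 2 * s) ^ 2)
    (hx2 : -3 * s < x 2) (hx3 : x 2 < 2 * s) {u : EuclideanSpace ℝ (Fin 3)}
    (hu0 : u 0 = x 0) (hu1 : u 1 = x 1) (hu2 : u 2 = 0) :
    ∃ K : ℝ, 2 * s ≤ K ∧ fderiv ℝ (fillFun F P s δ ((1 + s) ^ 2 + ε₀ + 2)) x u = K * hsq x := by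
  obtain ⟨hs, hs1, -, -, hδ, -⟩ := scales hS
  set M := (1 + s) ^ 2 + ε₀ + 2 with hM
  have hPd := hP.differentiable
  have hFd : Differentiable ℝ F := hN.hF.differentiable (by simp)
  have hD := (hasFDerivAt_fillFun hPd hδ.ne' hFd hP.hP x (s := s) (M := M)).fderiv
  obtain ⟨-, hDF⟩ := fderiv_F_eq_dhsq hN hS hx1 (abs_lt.2 ⟨by linarith, by linarith⟩)
  have hDw : fderiv ℝ (fillWeight P s δ M) x = fderiv ℝ (lidFun P s) x := by
    rw [(fillWeight_eventuallyEq hS hx1 hx2 hx3).fderiv_eq]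
    exact ((contDiff_lidFun hP.hP).differentiable (by simp) x).hasFDerivAt.const_add 1 |>.fderiv
  set θ₁ := deriv P ((F x - (fillWeight P s δ M x - 1)) / δ) with hθ₁
  obtain ⟨hθ0, hθ1⟩ := hP.hPd ((F x - (fillWeight P s δ M x - 1)) / δ)
  have hlid := fderiv_lidFun_apply_of_coord_two_eq_zero hPd hs x hu2 (P := P)
  have hcoef := two_mul_le_horizCoeff hP.hPd (by linarith : s ≤ 1) x (P := P)
  set μh := 2 * s * (1 - deriv P ((rimFun s x - topFun s x) / (s / 8))) +
    2 * deriv P ((rimFun s x - topFun s x) / (s / 8)) with hμh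
  refine ⟨(1 - θ₁) * 2 + θ₁ * μh, by nlinarith, ?_⟩
  rw [hD]
  simp only [_root_.add_apply, FunLike.coe_smul, Pi.smul_apply, smul_eq_mul, hDF, hDw,
    dhsq_apply, hlid, hu0, hu1]
  have hh : hsq x = x 0 * x 0 + x 1 * x 1 := by simp [hsq, sq]
  rw [hh]; ring

omit hN hS in
/-- **On the axis, at heights `s/16 ≤ x₂ < s`, the model function is negative** (there
`F_M = x₂ - s` exactly). [folklore] -/
theorem FM_axis_neg (hs : 0 < s) (hs1 : s ≤ 1 / 8) {x : EuclideanSpace ℝ (Fin 3)} (hx : hsq x = 0)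
    (hz1 : s / 16 ≤ x 2) (hz2 : x 2 < s) : FM P s x < 0 := by
  have hκ : (0 : ℝ) < s / 8 := by positivity
  have htop : topFun s x = x 2 - s := by unfold topFun; rw [hx]; ring
  have hrim : rimFun' s x = -(1 + s) ^ 2 := by unfold rimFun'; rw [hx]; ring
  have hlid : lid' P s x = x 2 - s := by
    unfold lid'
    rw [htop, hrim]
    have harg : (-(1 + s) ^ 2 - (x 2 - s)) / (s / 8) ≤ -1 := by
      rw [div_le_iff₀ hκ]; nlinarith
    rw [hP.hP0 _ harg]; ring
  unfold FM
  rw [hlid]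
  have harg : (bot s x - (x 2 - s)) / (s / 8) ≤ -1 := by
    unfold bot; rw [div_le_iff₀ hκ]; linarith
  rw [hP.hP0 _ harg]
  linarith

end Values

/-! ### §2 The absorption -/

/-- The unit vertical vector as a point of the unit sphere. [folklore] -/
theorem norm_single_two : ‖(EuclideanSpace.single (2 : Fin 3) (1 : ℝ) : EuclideanSpace ℝ (Fin 3))‖ = 1 := by
  simp

set_option maxHeartbeats 1600000 in
/-- **The sweep function of the absorption** (Schultens (2014), Lemma 3.2.3 applied in the proof
of Thm. 3.2.5, PDF p. 45).  In the normal form of the step, let `F_B` be a side function of the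
sub-sphere `W` (smooth, zero set `W`, regular there, `B = {F_B ≤ 0} ⊆ A₁ = {F₂ ≤ 0}`, positively
co-oriented with the sub-sphere function along `W`, and with the standard face), and let `Φ_B` be
a diffeomorphism of `ℝ³` with `Φ_B(𝔻̄) = B` (the induction hypothesis "`B` is a ball").  Then
there is a smooth `w : ℝ³ → ℝ` satisfying the hypotheses of the sweep transfer lemma
(`SweepTransfer.exists_sweep`) for `A₁ ⊇ B`, the face box
`G₀ = {ρ² < (1 + 3s/2)², -9s/4 < x₂ < 5s/4}` and `δ₀ = 1/16`, and moreover: `w < 1` at the points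
of `W` off the closed box; at points of `B` with `w ≥ 3/4`, and at points of `A₁` in the closed
face box above height `-3s/8`, `w` is the standard sweep function `w_std` (bowl
`z_b = 3s/8 + (s/8)ρ²`, `κ = s`) nearby; points of `B` with `w ≥ 3/4` lie in the model solid; and
points of `A₁ ∖ B` in the closed face box lie above height `-3s/8`.
[cite: Schultens2014, Lemma 3.2.3 and proof of Thm. 3.2.5 (PDF pp. 42–45)] -/
theorem exists_sweepFunction (hP : Admissible P) (hN : StepNF F E₁ E₂ w₀ η₀ ε₀) (hS : StepScale s δ w₀ η₀)
    {FB : EuclideanSpace ℝ (Fin 3) → ℝ} (hFBs : ContDiff ℝ ∞ FB)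
    (hFBW : ∀ x, FB x = 0 ↔ x ∈ subSphere F P E₁ s δ ε₀)
    (hFBreg : ∀ x, FB x = 0 → fderiv ℝ FB x ≠ 0)
    (hBsub : ∀ x, FB x ≤ 0 → fillFun F P s δ ((1 + s) ^ 2 + ε₀ + 2) x ≤ 0)
    (hco : ∀ x ∈ subSphere F P E₁ s δ ε₀, ∃ μ : ℝ, 0 < μ ∧
      fderiv ℝ FB x = μ • fderiv ℝ (subFun F P s δ ((1 + s) ^ 2 + ε₀ + 2)) x)
    (hface : StdFace FB P s)
    (ΦB : EuclideanSpace ℝ (Fin 3) ≃ₘ⟮𝓘(ℝ, EuclideanSpace ℝ (Fin 3)), 𝓘(ℝ, EuclideanSpace ℝ (Fin 3))⟯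
      EuclideanSpace ℝ (Fin 3))
    (hΦBD : ΦB '' closedBall 0 1 = {x | FB x ≤ 0}) (hΦBS : ΦB '' sphere 0 1 = {x | FB x = 0})
    (hΦBo : ΦB '' ball 0 1 = {x | FB x < 0})
    {ε₁ : ℝ} (hε₁ : 0 < ε₁) (hK₁ : IsCompact {x | fillFun F P s δ ((1 + s) ^ 2 + ε₀ + 2) x ≤ ε₁}) :
    ∃ w : EuclideanSpace ℝ (Fin 3) → ℝ, ContDiff ℝ ∞ w ∧
      (∀ b, FB b = 0 → w b ≤ 1 + 3 * (1 / 16) → b ∉ {x | hsq x < (1 + 3 * s / 2) ^ 2 ∧ -(9 * s / 4) < x 2 ∧ x 2 < 5 * s / 4} →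
        ∀ᶠ y in 𝓝 b, (fillFun F P s δ ((1 + s) ^ 2 + ε₀ + 2) y ≤ 0 ↔ FB y ≤ 0)) ∧
      (∀ x ∈ frontier {x | hsq x < (1 + 3 * s / 2) ^ 2 ∧ -(9 * s / 4) < x 2 ∧ x 2 < 5 * s / 4}, fillFun F P s δ ((1 + s) ^ 2 + ε₀ + 2) x ≤ 0 →
        w x ≤ 1 + 4 * (1 / 16) → FB x ≤ 0) ∧
      (∀ x, FB x ≤ 0 → w x ≤ 1 + 3 * (1 / 16) → fderiv ℝ w x ≠ 0) ∧
      (∀ x ∈ {x | hsq x < (1 + 3 * s / 2) ^ 2 ∧ -(9 * s / 4) < x 2 ∧ x 2 < 5 * s / 4}, fillFun F P s δ ((1 + s) ^ 2 + ε₀ + 2) x ≤ 0 → w x ≤ 1 + 3 * (1 / 16) →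
        fderiv ℝ w x ≠ 0) ∧
      (∀ x, FB x = 0 → x ∉ {x | hsq x < (1 + 3 * s / 2) ^ 2 ∧ -(9 * s / 4) < x 2 ∧ x 2 < 5 * s / 4} → w x ≤ 1 + 3 * (1 / 16) → ∀ c : ℝ, 0 ≤ c →
        fderiv ℝ w x ≠ c • fderiv ℝ FB x) ∧
      (∀ x, FB x = 0 → fillFun F P s δ ((1 + s) ^ 2 + ε₀ + 2) x = 0 → x ∉ {x | hsq x < (1 + 3 * s / 2) ^ 2 ∧ -(9 * s / 4) < x 2 ∧ x 2 < 5 * s / 4} →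
        w x ≤ 1 + 3 * (1 / 16) → ∃ μ : ℝ, 0 < μ ∧
          fderiv ℝ (fillFun F P s δ ((1 + s) ^ 2 + ε₀ + 2)) x = μ • fderiv ℝ FB x) ∧
      (∀ x ∈ {x | hsq x < (1 + 3 * s / 2) ^ 2 ∧ -(9 * s / 4) < x 2 ∧ x 2 < 5 * s / 4}, fillFun F P s δ ((1 + s) ^ 2 + ε₀ + 2) x = 0 → w x ≤ 1 + 3 * (1 / 16) →
        ∀ c : ℝ, 0 ≤ c → fderiv ℝ w x ≠ c • fderiv ℝ (fillFun F P s δ ((1 + s) ^ 2 + ε₀ + 2)) x) ∧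
      (∀ b, FB b = 0 → b ∉ closedBox s → w b < 1) ∧
      (∀ x, FB x ≤ 0 → 3 / 4 ≤ w x → (w =ᶠ[𝓝 x] wstd s (s / 8) s) ∧ FM P s x ≤ 0) ∧
      (∀ x, x ∈ closure {x | hsq x < (1 + 3 * s / 2) ^ 2 ∧ -(9 * s / 4) < x 2 ∧ x 2 < 5 * s / 4} → fillFun F P s δ ((1 + s) ^ 2 + ε₀ + 2) x ≤ 0 → -(3 * s / 8) < x 2 →
        w =ᶠ[𝓝 x] wstd s (s / 8) s) ∧
      (∀ x, x ∈ closure {x | hsq x < (1 + 3 * s / 2) ^ 2 ∧ -(9 * s / 4) < x 2 ∧ x 2 < 5 * s / 4} → fillFun F P s δ ((1 + s) ^ 2 + ε₀ + 2) x ≤ 0 → 0 < FB x →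
        -(3 * s / 8) < x 2) := by
  obtain ⟨hs, hs1, hsw, hsη, hδ, hδs⟩ := scales hS
  set M₀ : ℝ := (1 + s) ^ 2 + ε₀ + 2 with hM₀
  set F₂ : EuclideanSpace ℝ (Fin 3) → ℝ := fillFun F P s δ M₀ with hF₂
  set W : Set (EuclideanSpace ℝ (Fin 3)) := subSphere F P E₁ s δ ε₀ with hW
  have hPd := hP.differentiable
  have hε₀ := hN.hε₀
  have hF₂s : ContDiff ℝ ∞ F₂ := contDiff_fillFun hN.hF hP.hP
  have hF₂c : Continuous F₂ := hF₂s.continuous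
  have hFBc : Continuous FB := hFBs.continuous
  have hreg₂ : ∀ x, F₂ x = 0 → fderiv ℝ F₂ x ≠ 0 := fun x hx =>
    fderiv_fillFun_ne_zero hP.hP hP.hP0 hP.hPd hP.hPge hP.hPle hN.hF hε₀ hN.hreg hs hs1 hsw
      (by linarith) hN.hNFa hN.hNFb hδ (by linarith) hx
  -- constants
  set lam : ℝ := s / 8 with hlam
  set δ₀ : ℝ := 1 / 16 with hδ₀
  set m : ℝ := s / 32 with hm
  have hlam0 : 0 < lam := by positivity
  have hs0 : 0 < s := hs
  have hδ₀0 : (0 : ℝ) < δ₀ := by norm_num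
  have h3δ : 3 * δ₀ < (s / 2 + lam) / s := by
    rw [hδ₀, hlam, lt_div_iff₀ hs]; nlinarith
  have hm0 : 0 < m := by positivity
  have hm1 : m < 1 := by rw [hm]; linarith
  -- the model and its parametrisation
  obtain ⟨ΦM, hΦM, hΦMD, hΦMS, hΦMo⟩ :=
    exists_modelDiffeo hP.hP hP.hP0 hP.hP1 hP.hPd hP.hPge hP.hPle hs hs1 (P := P)
  -- `B`, `W` read through `F_B`
  have hBcpt : IsCompact {x | FB x ≤ 0} :=
    hK₁.of_isClosed_subset (isClosed_le hFBc continuous_const) fun x hx => (hBsub x hx).trans hε₁.le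
  have hWeq : {x | FB x = 0} = W := Set.ext fun x => hFBW x
  -- agreement of `M` and `B`
  have hMB : ∀ x, FM P s x ≤ 0 → FB x ≤ 0 := fun x hx => ModelSweep.FB_nonpos_of_FM_nonpos hP hs hface hx
  have hsub : ΦM '' closedBall 0 1 ⊆ ΦB '' closedBall 0 1 := by
    rw [hΦMD, hΦBD]; exact fun x hx => hMB x hx
  have hsph : ∀ y : EuclideanSpace ℝ (Fin 3), ‖y‖ = 1 →
      0 < ⟪(EuclideanSpace.single (2 : Fin 3) (1 : ℝ) : EuclideanSpace ℝ (Fin 3)), y⟫ → ΦM y ∈ ΦB '' sphere 0 1 := by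
    intro y hy hpos
    rw [EuclideanSpace.inner_single_left, map_one, one_mul] at hpos
    rw [hΦBS, mem_setOf_eq]
    have hz : FM P s (ΦM y) = 0 := by
      have : ΦM y ∈ ΦM '' sphere 0 1 := ⟨y, mem_sphere_zero_iff_norm.2 hy, rfl⟩
      rw [hΦMS] at this; exact this
    have hh : -(s / 2) < (ΦM y) 2 := by rw [hΦM]; exact ModelSweep.height_of_pos hP hs hs1 hpos
    obtain ⟨-, -, hLZ⟩ := ModelSweep.bounds_of_FM_nonpos hP hs hz.le
    exact ((ModelSweep.sign_iff_FM hP hs hface hh.le hLZ).2.1).2 hz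
  -- the aligned parametrisation of `B`
  obtain ⟨Ψ, Ψinv, δ', hδ'0, hδ'1, hΨs, hΨinj, hΨopen, hΨinvs, hΨleft, hΨright, hΨD, hΨS, hΨo, hΨagree⟩ :=
    AlignAssembly.exists_alignedParam (n := 2) two_ne_zero
      ⟨EuclideanSpace.single (2 : Fin 3) (1 : ℝ), mem_sphere_zero_iff_norm.2 norm_single_two⟩ ΦB ΦM hm0 hm1 hsub hsph
  have hΨagree' : ∀ y : EuclideanSpace ℝ (Fin 3), ‖y‖ < 1 + δ' → m ≤ y 2 → Ψ y = ΦM y := fun y hy hym =>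
    hΨagree y hy (by rw [EuclideanSpace.inner_single_left, map_one, one_mul]; exact hym)
  rw [hΦBD] at hΨD; rw [hΦBS] at hΨS; rw [hΦBo] at hΨo
  have hΨD' : {x | FB x ≤ 0} = Ψ '' closedBall 0 1 := hΨD.symm
  have hballδ : ∀ {t : ℝ}, t ≤ δ' → ball (0 : EuclideanSpace ℝ (Fin 3)) (1 + t) ⊆ ball 0 (1 + δ') :=
    fun ht => ball_subset_ball (by linarith)
  -- the transported function `H = w_std ∘ Φ_M`
  set H : EuclideanSpace ℝ (Fin 3) → ℝ := fun y => wstd s lam s (ΦM y) with hH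
  have hHs : ContDiff ℝ ∞ H := ModelSweep.contDiff_comp ΦM lam s
  -- the explicit region above height `-3s/8` outside the model
  set Rexp : Set (EuclideanSpace ℝ (Fin 3)) := {x | x ∈ lidZone s ∧ -(3 * s / 8) < x 2 ∧ 0 < FM P s x} with hRexp
  have hFMc : Continuous (FM P s) := (contDiff_FM hP.hP).continuous
  have hRo : IsOpen Rexp :=
    (isOpen_lidZone s).inter ((isOpen_lt continuous_const (continuous_coord 2)).inter
      (isOpen_lt continuous_const hFMc))
  have hRcl : closure Rexp ⊆ {x | hsq x ≤ (1 + 2 * s) ^ 2 ∧ -(3 * s / 8) ≤ x 2 ∧ x 2 ≤ 3 * s / 2} := by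
    refine closure_minimal ?_ ?_
    · rintro x ⟨⟨h1, h2, h3⟩, h4, -⟩; exact ⟨h1.le, h4.le, h3.le⟩
    · exact (isClosed_le continuous_hsq continuous_const).inter
        ((isClosed_le continuous_const (continuous_coord 2)).inter (isClosed_le (continuous_coord 2) continuous_const))
  -- `F_M > 0` (resp. `= 0`) versus `F_B` above height `-s/2` in the lid zone
  have hFBpos_of : ∀ x, x ∈ lidZone s → -(s / 2) ≤ x 2 → 0 < FM P s x → 0 < FB x := fun x hLZ hz hpos => by
    have := (ModelSweep.sign_iff_FM hP hs hface hz hLZ).1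
    by_contra hle; push Not at hle
    exact absurd (this.1 hle) (not_le.2 hpos)
  have hFMpos_of : ∀ x, x ∈ lidZone s → -(s / 2) ≤ x 2 → 0 < FB x → 0 < FM P s x := fun x hLZ hz hpos => by
    have := (ModelSweep.sign_iff_FM hP hs hface hz hLZ).1
    by_contra hle; push Not at hle
    exact absurd (this.2 hle) (not_le.2 hpos)
  -- points of `W` in the closure of the explicit region are high points of `∂M`
  have hWcl : ∀ x, FB x = 0 → x ∈ closure Rexp → ∃ y, ‖y‖ = 1 ∧ m < y 2 ∧ ΦM y = x := by
    intro x hx hcl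
    obtain ⟨h1, h2, h3⟩ := hRcl hcl
    have hxW : x ∈ W := (hFBW x).1 hx
    rw [hW, subSphere_eq hP hN hS] at hxW
    rcases hxW with (⟨hG, hz3⟩ | ⟨-, hz5, -⟩) | ⟨-, hxB⟩
    · -- a lid point above `-3s/8`: a zero of `F_M`
      have hFM0 : FM P s x = 0 := ((FM_iff_lidFun hP.hP0 hP.hPge hP.hPle hs (show -(s / 2) ≤ x 2 by linarith)).2.1).2 hG
      have : x ∈ ΦM '' sphere 0 1 := by rw [hΦMS]; exact hFM0
      obtain ⟨y, hy, rfl⟩ := this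
      refine ⟨y, mem_sphere_zero_iff_norm.1 hy, ?_, rfl⟩
      have hz : -(s / 2) + s / 8 ≤ (RadialBallMap.rmap (p0 s) (prof P s) (s / 8) y) 2 := by
        rw [← hΦM]; linarith
      have := ModelSweep.zone_of_height' hP hs hs1 (by positivity) hz
      rw [hm]; linarith
    · exfalso; linarith
    · exfalso; exact hxB ⟨by nlinarith, by linarith, by linarith⟩
  -- the compact lower part of the sphere and the shrink of the shell
  set Kcap : Set (EuclideanSpace ℝ (Fin 3)) := {y | ‖y‖ = 1 ∧ y 2 ≤ m} with hKcap
  have hKcpt : IsCompact Kcap := by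
    refine (isCompact_sphere (0 : EuclideanSpace ℝ (Fin 3)) 1).of_isClosed_subset ?_ ?_
    · exact (isClosed_eq continuous_norm continuous_const).inter (isClosed_le (continuous_coord 2) continuous_const)
    · rintro y ⟨hy, -⟩; exact mem_sphere_zero_iff_norm.2 hy
  set U : Set (EuclideanSpace ℝ (Fin 3)) := ball 0 (1 + δ') ∩ Ψ ⁻¹' (closure Rexp)ᶜ with hU
  have hUo : IsOpen U := hΨs.continuousOn.isOpen_inter_preimage isOpen_ball isClosed_closure.isOpen_compl
  have hKU : Kcap ⊆ U := by
    rintro y ⟨hy1, hym⟩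
    refine ⟨mem_ball_zero_iff.2 (by linarith), ?_⟩
    show Ψ y ∉ closure Rexp
    intro hcl
    have hyW : FB (Ψ y) = 0 := by
      have : Ψ y ∈ Ψ '' sphere 0 1 := ⟨y, mem_sphere_zero_iff_norm.2 hy1, rfl⟩
      rw [hΨS] at this; exact this
    obtain ⟨y', hy'1, hy'm, he⟩ := hWcl _ hyW hcl
    have hΨy' : Ψ y' = ΦM y' := hΨagree' y' (by rw [hy'1]; linarith) hy'm.le
    rw [← hΨy'] at he
    have := hΨinj (mem_ball_zero_iff.2 (by rw [hy'1]; linarith)) (mem_ball_zero_iff.2 (by rw [hy1]; linarith)) he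
    rw [this] at hy'm
    linarith
  obtain ⟨ε, hε, hεU⟩ := hKcpt.exists_cthickening_subset_open hUo hKU
  set δ'' : ℝ := min δ' (ε / 2) with hδ''
  have hδ''0 : 0 < δ'' := lt_min hδ'0 (by linarith)
  have hδ''le : δ'' ≤ δ' := min_le_left _ _
  have hδ''ε : δ'' < ε := lt_of_le_of_lt (min_le_right _ _) (by linarith)
  -- shell points whose image meets the closure of the explicit region lie in the zone
  have key_shell : ∀ y : EuclideanSpace ℝ (Fin 3), 1 ≤ ‖y‖ → ‖y‖ < 1 + δ'' → Ψ y ∈ closure Rexp → m ≤ y 2 := by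
    intro y hy1 hy2 hcl
    by_contra hlt
    push Not at hlt
    have hny : 0 < ‖y‖ := by linarith
    set yh : EuclideanSpace ℝ (Fin 3) := ‖y‖⁻¹ • y with hyh
    have hn : ‖yh‖ = 1 := by
      rw [hyh, norm_smul, Real.norm_eq_abs, abs_of_pos (inv_pos.2 hny), inv_mul_cancel₀ hny.ne']
    have hyh2 : yh 2 ≤ m := by
      have : yh 2 = ‖y‖⁻¹ * y 2 := by simp [hyh]
      rw [this]
      have hinv : 0 < ‖y‖⁻¹ := inv_pos.2 hny
      have hinv1 : ‖y‖⁻¹ ≤ 1 := inv_le_one_of_one_le₀ hy1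
      rcases le_or_gt (y 2) 0 with h0 | h0
      · exact le_trans (mul_nonpos_of_nonneg_of_nonpos hinv.le h0) hm0.le
      · calc ‖y‖⁻¹ * y 2 ≤ 1 * y 2 := by nlinarith
          _ ≤ m := by linarith
    have hmem : y ∈ cthickening ε Kcap := by
      refine thickening_subset_cthickening ε Kcap (Metric.mem_thickening_iff.2 ⟨yh, ⟨hn, hyh2⟩, ?_⟩)
      have : y - yh = (1 - ‖y‖⁻¹) • y := by rw [hyh, sub_smul, one_smul]
      rw [dist_eq_norm, this, norm_smul, Real.norm_eq_abs, abs_of_nonneg (by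
        rw [sub_nonneg]; exact inv_le_one_of_one_le₀ hy1)]
      have : (1 - ‖y‖⁻¹) * ‖y‖ = ‖y‖ - 1 := by field_simp
      rw [this]; linarith
    exact (hεU hmem).2 hcl
  -- the neighbourhood `Ω₁` of `B` on which `w = H ∘ Ψ⁻¹`
  set Ω₁ : Set (EuclideanSpace ℝ (Fin 3)) := Ψ '' ball 0 (1 + δ'') with hΩ₁
  have hΩ₁o : IsOpen Ω₁ :=
    AlignAssembly.isOpen_image_of_inverse hΨopen hΨinvs.continuousOn hΨleft isOpen_ball (hballδ hδ''le)
  have hΩ₁sub : Ω₁ ⊆ Ψ '' ball 0 (1 + δ') := image_mono (hballδ hδ''le)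
  have hBΩ₁ : {x | FB x ≤ 0} ⊆ Ω₁ := by
    rw [hΨD']; exact image_mono (closedBall_subset_ball (by linarith))
  -- on `Ω₁ ∩ Rexp` the two local expressions agree
  have hagree : ∀ x ∈ Ω₁ ∩ Rexp, H (Ψinv x) = wstd s lam s x := by
    rintro _ ⟨⟨y, hy, rfl⟩, hxR⟩
    have hy' : ‖y‖ < 1 + δ'' := mem_ball_zero_iff.1 hy
    have hyδ' : y ∈ ball (0 : EuclideanSpace ℝ (Fin 3)) (1 + δ') := hballδ hδ''le hy
    have hy1 : 1 ≤ ‖y‖ := by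
      by_contra hlt
      push Not at hlt
      have hin : Ψ y ∈ Ψ '' ball 0 1 := ⟨y, mem_ball_zero_iff.2 hlt, rfl⟩
      rw [hΨo] at hin
      have hpos : 0 < FB (Ψ y) := hFBpos_of _ hxR.1 (by linarith [hxR.2.1]) hxR.2.2
      exact absurd hin (not_lt.2 hpos.le)
    have hym := key_shell y hy1 hy' (subset_closure hxR)
    have hΨy : Ψ y = ΦM y := hΨagree' y (mem_ball_zero_iff.1 hyδ') hym
    rw [hΨleft y hyδ']
    show wstd s lam s (ΦM y) = wstd s lam s (Ψ y)
    rw [hΨy]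
  -- the face box `G₀` and the compact set near which `w` is prescribed
  set G₀ : Set (EuclideanSpace ℝ (Fin 3)) :=
    {x | hsq x < (1 + 3 * s / 2) ^ 2 ∧ -(9 * s / 4) < x 2 ∧ x 2 < 5 * s / 4} with hG₀
  have hG₀o : IsOpen G₀ := (isOpen_lt continuous_hsq continuous_const).inter
    ((isOpen_lt continuous_const (continuous_coord 2)).inter (isOpen_lt (continuous_coord 2) continuous_const))
  have hG₀cl : closure G₀ ⊆ {x | hsq x ≤ (1 + 3 * s / 2) ^ 2 ∧ -(9 * s / 4) ≤ x 2 ∧ x 2 ≤ 5 * s / 4} := by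
    refine closure_minimal ?_ ?_
    · rintro x ⟨h1, h2, h3⟩; exact ⟨h1.le, h2.le, h3.le⟩
    · exact (isClosed_le continuous_hsq continuous_const).inter
        ((isClosed_le continuous_const (continuous_coord 2)).inter (isClosed_le (continuous_coord 2) continuous_const))
  have hG₀LZ : closure G₀ ⊆ lidZone s := fun x hx => by
    obtain ⟨h1, h2, h3⟩ := hG₀cl hx
    exact ⟨by nlinarith, by linarith, by linarith⟩
  -- a point of `A₁` in the closed face box outside `B` lies in the explicit region
  have hRexp_of : ∀ x, x ∈ closure G₀ → F₂ x ≤ 0 → 0 < FB x → x ∈ Rexp := by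
    intro x hx hA hpos
    obtain ⟨h1, h2, h3⟩ := hG₀cl hx
    have hLZ := hG₀LZ hx
    have hz : -(3 * s / 8) < x 2 := by
      by_contra hle; push Not at hle
      have := FB_nonpos_of_low hP hN hS hface hLZ.1 (by linarith) hle hA
      linarith
    exact ⟨hLZ, hz, hFMpos_of x hLZ (by linarith) hpos⟩
  set K₀ : Set (EuclideanSpace ℝ (Fin 3)) := {x | FB x ≤ 0} ∪ ({x | F₂ x ≤ 0} ∩ closure G₀) with hK₀
  have hA₁cpt : IsCompact {x | F₂ x ≤ 0} :=
    hK₁.of_isClosed_subset (isClosed_le hF₂c continuous_const) fun x hx => le_trans hx hε₁.le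
  have hK₀cpt : IsCompact K₀ := hBcpt.union (hA₁cpt.inter_right isClosed_closure)
  have hK₀sub : K₀ ⊆ Ω₁ ∪ Rexp := by
    rintro x (hx | ⟨hA, hcl⟩)
    · exact Or.inl (hBΩ₁ hx)
    · by_cases hB : FB x ≤ 0
      · exact Or.inl (hBΩ₁ hB)
      · push Not at hB
        exact Or.inr (hRexp_of x hcl hA hB)
  -- the glued sweep function
  have hg₁ : ContDiffOn ℝ ∞ (fun x => H (Ψinv x)) Ω₁ := hHs.comp_contDiffOn (hΨinvs.mono hΩ₁sub)
  obtain ⟨w, N₀, hws, hN₀o, hK₀N, -, hw₁, hw₂⟩ :=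
    SweepGlue.exists_contDiff_eqOn_of_compact hΩ₁o hRo hg₁ ((contDiff_wstd s lam s).contDiffOn) hagree
      hK₀cpt hK₀sub 2
  -- `w = H ∘ Ψ⁻¹` near `B`
  have hw_B : ∀ x, FB x ≤ 0 → w =ᶠ[𝓝 x] fun x => H (Ψinv x) := fun x hx => by
    have hmem : x ∈ N₀ ∩ Ω₁ := ⟨hK₀N (Or.inl hx), hBΩ₁ hx⟩
    filter_upwards [(hN₀o.inter hΩ₁o).mem_nhds hmem] with y hy using hw₁ y hy
  -- the open zone image, on which `H ∘ Ψ⁻¹ = w_std`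
  set Vz : Set (EuclideanSpace ℝ (Fin 3)) := Ψ '' (ball 0 (1 + δ'') ∩ {y | m < y 2}) with hVz
  have hVzo : IsOpen Vz := by
    refine AlignAssembly.isOpen_image_of_inverse hΨopen hΨinvs.continuousOn hΨleft
      (isOpen_ball.inter (isOpen_lt continuous_const (continuous_coord 2))) ?_
    exact inter_subset_left.trans (hballδ hδ''le)
  have hVzΩ₁ : Vz ⊆ Ω₁ := image_mono inter_subset_left
  have hVz_std : ∀ x ∈ Vz, H (Ψinv x) = wstd s lam s x := by
    rintro _ ⟨y, ⟨hy, hym⟩, rfl⟩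
    have hyδ' : y ∈ ball (0 : EuclideanSpace ℝ (Fin 3)) (1 + δ') := hballδ hδ''le hy
    rw [hΨleft y hyδ']
    show wstd s lam s (ΦM y) = wstd s lam s (Ψ y)
    rw [hΨagree' y (mem_ball_zero_iff.1 hyδ') hym.le]
  have hM_Vz : ∀ x, FM P s x ≤ 0 → -(3 * s / 8) < x 2 → x ∈ Vz := by
    intro x hx hz
    have : x ∈ ΦM '' closedBall 0 1 := by rw [hΦMD]; exact hx
    obtain ⟨y, hy, rfl⟩ := this
    have hy1 := mem_closedBall_zero_iff.1 hy
    have hzone : -(s / 2) + s / 8 ≤ (RadialBallMap.rmap (p0 s) (prof P s) (s / 8) y) 2 := by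
      rw [← hΦM]; linarith
    have hym : m < y 2 := by
      have := ModelSweep.zone_of_height' hP hs hs1 (by positivity) hzone
      rw [hm]; linarith
    have hyb : y ∈ ball (0 : EuclideanSpace ℝ (Fin 3)) (1 + δ'') := mem_ball_zero_iff.2 (by linarith)
    refine ⟨y, ⟨hyb, hym⟩, ?_⟩
    exact hΨagree' y (mem_ball_zero_iff.1 (hballδ hδ''le hyb)) hym.le
  -- `w = w_std` near the high points of `A₁` in the closed face box
  have hw_std : ∀ x, x ∈ closure G₀ → F₂ x ≤ 0 → -(3 * s / 8) < x 2 → w =ᶠ[𝓝 x] wstd s lam s := by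
    intro x hcl hA hz
    have hxN : x ∈ N₀ := hK₀N (Or.inr ⟨hA, hcl⟩)
    by_cases hB : FB x ≤ 0
    · -- inside `B`: a point of the model above `-3s/8`, in the zone image
      have hLZ := hG₀LZ hcl
      have hFM : FM P s x ≤ 0 := (ModelSweep.sign_iff_FM hP hs hface (by linarith) hLZ).1.1 hB
      have hxV : x ∈ Vz := hM_Vz x hFM hz
      filter_upwards [(hN₀o.inter hVzo).mem_nhds ⟨hxN, hxV⟩] with y hy
      rw [hw₁ y ⟨hy.1, hVzΩ₁ hy.2⟩]
      exact hVz_std y hy.2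
    · push Not at hB
      have hxR : x ∈ Rexp := hRexp_of x hcl hA hB
      filter_upwards [(hN₀o.inter hRo).mem_nhds ⟨hxN, hxR⟩] with y hy using hw₂ y hy
  -- derivative data at points of `B`: `y = Ψ⁻¹ b`, the isomorphism `L = DΨ(y)`
  have hΨdata : ∀ b, FB b ≤ 0 → ∃ (y : EuclideanSpace ℝ (Fin 3)) (L : EuclideanSpace ℝ (Fin 3) ≃L[ℝ] EuclideanSpace ℝ (Fin 3)),
      y ∈ ball (0 : EuclideanSpace ℝ (Fin 3)) (1 + δ') ∧ Ψ y = b ∧ Ψinv b = y ∧ ‖y‖ ≤ 1 ∧ (FB b = 0 → ‖y‖ = 1) ∧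
      (L : EuclideanSpace ℝ (Fin 3) →L[ℝ] EuclideanSpace ℝ (Fin 3)) = fderiv ℝ Ψ y ∧
      fderiv ℝ w b = (fderiv ℝ H y).comp (L.symm : EuclideanSpace ℝ (Fin 3) →L[ℝ] EuclideanSpace ℝ (Fin 3)) := by
    intro b hb
    have hbD : b ∈ Ψ '' closedBall 0 1 := by rw [← hΨD']; exact hb
    obtain ⟨y, hy, rfl⟩ := hbD
    have hy1 := mem_closedBall_zero_iff.1 hy
    have hyb : y ∈ ball (0 : EuclideanSpace ℝ (Fin 3)) (1 + δ') := mem_ball_zero_iff.2 (by linarith)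
    obtain ⟨L, hL, hLs⟩ := ModelSweep.exists_fderiv_eq_equiv_of_inverse isOpen_ball hΨs hΨopen hΨinvs hΨleft hyb
    refine ⟨y, L, hyb, rfl, hΨleft y hyb, hy1, fun h0 => ?_, hL, ?_⟩
    · have : Ψ y ∈ Ψ '' sphere 0 1 := by rw [hΨS]; exact h0
      obtain ⟨y', hy', he⟩ := this
      rw [← hΨinj (hballδ le_rfl (sphere_subset_closedBall.trans (closedBall_subset_ball (by linarith)) hy')) hyb he]
      exact mem_sphere_zero_iff_norm.1 hy'
    · -- chain rule for `H ∘ Ψ⁻¹` at `Ψ y`, transferred to `w`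
      have h1 : HasFDerivAt Ψinv (L.symm : EuclideanSpace ℝ (Fin 3) →L[ℝ] EuclideanSpace ℝ (Fin 3)) (Ψ y) := by
        rw [hLs]
        exact ((hΨinvs.differentiableOn (by simp)).differentiableAt (hΨopen.mem_nhds ⟨y, hyb, rfl⟩)).hasFDerivAt
      have h2 : HasFDerivAt H (fderiv ℝ H y) (Ψinv (Ψ y)) := by
        rw [hΨleft y hyb]; exact ((hHs.differentiable (by simp)) y).hasFDerivAt
      have h3 : HasFDerivAt (fun x => H (Ψinv x)) ((fderiv ℝ H y).comp (L.symm : EuclideanSpace ℝ (Fin 3) →L[ℝ] EuclideanSpace ℝ (Fin 3))) (Ψ y) :=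
        h2.comp (Ψ y) h1
      rw [(hw_B _ hb).fderiv_eq]
      exact h3.fderiv
  -- no critical points of `w` on `B`
  have core_B2 : ∀ b, FB b ≤ 0 → fderiv ℝ w b ≠ 0 := by
    intro b hb
    obtain ⟨y, L, -, -, -, -, -, -, hDw⟩ := hΨdata b hb
    rw [hDw]
    exact ModelSweep.comp_equiv_ne_zero L.symm (ModelSweep.fderiv_comp_ne_zero ΦM lam hs0.ne' y)
  -- the conormal of `F_B ∘ Ψ` at the unit sphere
  have hconormal : ∀ y : EuclideanSpace ℝ (Fin 3), ‖y‖ = 1 →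
      ∃ μ' : ℝ, 0 < μ' ∧ (fderiv ℝ FB (Ψ y)).comp (fderiv ℝ Ψ y) = μ' • innerSL ℝ y := by
    intro y hy
    have hyb : y ∈ ball (0 : EuclideanSpace ℝ (Fin 3)) (1 + δ') := mem_ball_zero_iff.2 (by linarith)
    have hfs : ContDiffOn ℝ ∞ (fun z => FB (Ψ z)) (ball 0 (1 + δ')) := hFBs.comp_contDiffOn hΨs
    obtain ⟨g, hgs, hgeq⟩ := SweepGlue.exists_contDiff_eventuallyEq isOpen_ball hfs hyb
    have hΨyW : FB (Ψ y) = 0 := by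
      have : Ψ y ∈ Ψ '' sphere 0 1 := ⟨y, mem_sphere_zero_iff_norm.2 hy, rfl⟩
      rw [hΨS] at this; exact this
    have hgy : g y = 0 := by rw [hgeq.eq_of_nhds]; exact hΨyW
    have hDg : fderiv ℝ g y = (fderiv ℝ FB (Ψ y)).comp (fderiv ℝ Ψ y) := by
      rw [hgeq.fderiv_eq]
      have h1 : DifferentiableAt ℝ FB (Ψ y) := (hFBs.differentiable (by simp)) _
      have h2 : DifferentiableAt ℝ Ψ y := (hΨs.differentiableOn (by simp)).differentiableAt (isOpen_ball.mem_nhds hyb)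
      exact fderiv_comp y h1 h2
    obtain ⟨L, hL, -⟩ := ModelSweep.exists_fderiv_eq_equiv_of_inverse isOpen_ball hΨs hΨopen hΨinvs hΨleft hyb
    have hDg0 : fderiv ℝ g y ≠ 0 := by
      rw [hDg, ← hL]; exact ModelSweep.comp_equiv_ne_zero L (hFBreg _ hΨyW)
    have hG₁ : Differentiable ℝ (fun z : EuclideanSpace ℝ (Fin 3) => ‖z‖ ^ 2 - 1) := fun z =>
      (ModelSweep.hasFDerivAt_norm_sq_sub_one z).differentiableAt
    have hD₁ : fderiv ℝ (fun z : EuclideanSpace ℝ (Fin 3) => ‖z‖ ^ 2 - 1) y ≠ 0 := by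
      rw [(ModelSweep.hasFDerivAt_norm_sq_sub_one y).fderiv]
      intro h
      have := congrArg (fun L : EuclideanSpace ℝ (Fin 3) →L[ℝ] ℝ => L y) h
      simp [hy] at this
    have hiff : ∀ᶠ z in 𝓝 y, (‖z‖ ^ 2 - 1 ≤ 0 ↔ g z ≤ 0) := by
      filter_upwards [hgeq, isOpen_ball.mem_nhds hyb] with z hz hzb
      rw [hz, sub_nonpos]
      have : FB (Ψ z) ≤ 0 ↔ ‖z‖ ≤ 1 := by
        constructor
        · intro h
          have : Ψ z ∈ Ψ '' closedBall 0 1 := by rw [← hΨD']; exact h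
          obtain ⟨z', hz', he⟩ := this
          rw [← hΨinj (closedBall_subset_ball (by linarith) hz' |> hballδ le_rfl) hzb he]
          exact mem_closedBall_zero_iff.1 hz'
        · intro h
          have : Ψ z ∈ Ψ '' closedBall 0 1 := ⟨z, mem_closedBall_zero_iff.2 h, rfl⟩
          rw [← hΨD'] at this; exact this
      rw [this]
      constructor
      · intro h; nlinarith [norm_nonneg z]
      · intro h; nlinarith [norm_nonneg z]
    obtain ⟨μ, hμ, hD⟩ := SchoenfliesTools.exists_pos_fderiv_eq_smul_of_eventually_iff hG₁
      (hgs.differentiable (by simp)) (by rw [hy]; norm_num) hgy hD₁ hDg0 hiff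
    refine ⟨μ * 2, by positivity, ?_⟩
    rw [← hDg, hD, (ModelSweep.hasFDerivAt_norm_sq_sub_one y).fderiv, smul_smul]
  -- the conormal condition at points of `W` with small `w`
  have core_B3 : ∀ b, FB b = 0 → w b ≤ 1 + 3 * δ₀ → ∀ c : ℝ, 0 ≤ c → fderiv ℝ w b ≠ c • fderiv ℝ FB b := by
    intro b hb hwb c hc h
    obtain ⟨y, L, hyb, hΨy, hΨinvb, -, hy1, hL, hDw⟩ := hΨdata b hb.le
    have hy := hy1 hb
    obtain ⟨μ', hμ', hco'⟩ := hconormal y hy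
    rw [hΨy, ← hL] at hco'
    -- `DH(y) ∘ L⁻¹ = c DF_B(b)` gives `DH(y) = c (DF_B(b) ∘ L) = (c μ') ⟪y, ·⟫`
    rw [hDw] at h
    have h' : fderiv ℝ H y = c • (fderiv ℝ FB b).comp (L : EuclideanSpace ℝ (Fin 3) →L[ℝ] EuclideanSpace ℝ (Fin 3)) := by
      have := congrArg (fun T : EuclideanSpace ℝ (Fin 3) →L[ℝ] ℝ => T.comp (L : EuclideanSpace ℝ (Fin 3) →L[ℝ] EuclideanSpace ℝ (Fin 3))) h
      simp only [ContinuousLinearMap.comp_assoc, ContinuousLinearEquiv.coe_symm_comp_coe,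
        ContinuousLinearMap.comp_id, ContinuousLinearMap.smul_comp] at this
      exact this
    rw [hco', smul_smul] at h'
    have hwy : wstd s lam s (ΦM y) ≤ 1 + 3 * δ₀ := by
      have : w b = H (Ψinv b) := (hw_B b hb.le).eq_of_nhds
      rw [this, hΨinvb] at hwb; exact hwb
    exact ModelSweep.comp_conormal ΦM hP hs hs1 hlam0 hs0 h3δ hΦMD hΦMS hy hwy (by positivity) h'
  -- at shared boundary points off the face box the sub-sphere function is `F₂` nearby
  have hlow_hsq : ∀ b, F₂ b = 0 → b ∈ closedBox s → b 2 ≤ -(5 * s / 2) → 1 ≤ hsq b ∧ hsq b < (1 + 2 * s) ^ 2 := by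
    intro b hb hbB hz
    refine ⟨one_le_hsq_of_fillFun_eq_zero hP hN hS hb hbB, ?_⟩
    obtain ⟨h1, h2, h3⟩ := hbB
    have hF : F b = hsq b - 1 := F_eq_of_box hN hS h1 (abs_le.2 ⟨by linarith, by linarith⟩)
    have hmin := min_sub_le_fillFun hP.hPle hδ (F := F) (s := s) (M := M₀) b (P := P)
    have hmin' : min (F b) (fillWeight P s δ M₀ b - 1) ≤ δ := by
      have : F₂ b = fillFun F P s δ M₀ b := rfl
      linarith [hb]
    rcases min_le_iff.1 hmin' with hF' | hw'
    · rw [hF] at hF'; nlinarith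
    · have hwt := one_add_lidFun_le_fillWeight hs hδ.le (by positivity : (0 : ℝ) ≤ M₀) b (P := P)
      have hrim : rimFun s b ≤ lidFun P s b := (le_max_right _ _).trans (max_le_lidFun hP.hPge hs b)
      unfold rimFun at hrim
      have hr1 := rimRadius_le hs (b 2)
      have hr0 := rimRadius_nonneg hs (b 2)
      nlinarith
  have hshared : ∀ b, FB b = 0 → b ∉ G₀ → subFun F P s δ M₀ =ᶠ[𝓝 b] F₂ := by
    intro b hb hbG
    have hbW : b ∈ W := (hFBW b).1 hb
    rw [hW, subSphere_eq hP hN hS] at hbW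
    apply subFun_eventuallyEq_fillFun hP hN hS
    rcases hbW with (⟨hG, hz3⟩ | ⟨hb0, hz5, hbB⟩) | ⟨-, hbB⟩
    · -- lid point off the face box: height `≤ -9s/4`
      obtain ⟨hzs, hhsq⟩ := bounds_of_lidFun_eq_zero hP hS hG
      have hz : b 2 ≤ -(9 * s / 4) := by
        by_contra hlt; push Not at hlt
        exact hbG ⟨by nlinarith, hlt, by linarith⟩
      have hh := hsq_ge_of_lidFun_eq_zero hP hS hG (by linarith) hz3
      exact Or.inr (Or.inr ⟨by linarith, by linarith, by nlinarith⟩)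
    · obtain ⟨hh1, hh2⟩ := hlow_hsq b hb0 hbB hz5
      exact Or.inr (Or.inr ⟨by linarith, by linarith, hh2⟩)
    · exact Or.inl hbB
  have hshared_D : ∀ b, FB b = 0 → b ∉ G₀ → ∃ μ : ℝ, 0 < μ ∧ fderiv ℝ F₂ b = μ • fderiv ℝ FB b := by
    intro b hb hbG
    obtain ⟨μ, hμ, hD⟩ := hco b ((hFBW b).1 hb)
    rw [(hshared b hb hbG).fderiv_eq] at hD
    refine ⟨μ⁻¹, inv_pos.2 hμ, ?_⟩
    rw [hD, smul_smul, inv_mul_cancel₀ hμ.ne', one_smul]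
  have hsubD : ∀ b, FB b = 0 → ∀ᶠ y in 𝓝 b, y ∈ subDomain E₁ s (4 * s) := fun b hb => by
    have hbW : b ∈ W := (hFBW b).1 hb
    exact (isOpen_subDomain hN.hE₁).mem_nhds hbW.1
  -- Hagree
  have Hagree : ∀ b, FB b = 0 → w b ≤ 1 + 3 * δ₀ → b ∉ G₀ → ∀ᶠ y in 𝓝 b, (F₂ y ≤ 0 ↔ FB y ≤ 0) := by
    intro b hb _ hbG
    obtain ⟨μ, hμ, hD⟩ := hshared_D b hb hbG
    have hZ : ∀ᶠ y in 𝓝 b, F₂ y = 0 ↔ FB y = 0 := by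
      filter_upwards [hshared b hb hbG, hsubD b hb] with y hy hyU
      rw [hFBW y]
      constructor
      · intro h; exact ⟨hyU, by rw [hy]; exact h⟩
      · rintro ⟨-, h⟩; rw [hy] at h; exact h
    have := SideComparison.eventually_sign_iff (hF₂s.of_le (by norm_cast)) (hFBs.of_le (by norm_cast)) hb hZ
      (hFBreg b hb) hμ hD
    filter_upwards [this] with y hy
    rw [← not_lt, ← not_lt, hy.2]
  -- Hbdry
  have Hbdry : ∀ x ∈ frontier G₀, F₂ x ≤ 0 → w x ≤ 1 + 4 * δ₀ → FB x ≤ 0 := by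
    intro x hx hA hwx
    rw [hG₀o.frontier_eq] at hx
    obtain ⟨hcl, hnot⟩ := hx
    obtain ⟨h1, h2, h3⟩ := hG₀cl hcl
    by_cases hz : x 2 ≤ -(3 * s / 8)
    · exact FB_nonpos_of_low hP hN hS hface (by nlinarith) (by linarith) hz hA
    · push Not at hz
      exfalso
      rcases h1.lt_or_eq with hlt | heq
      · -- the top face
        have hz5 : x 2 = 5 * s / 4 := by
          by_contra hne
          exact hnot ⟨hlt, by linarith, lt_of_le_of_ne h3 hne⟩
        have hwstd : w x = wstd s lam s x := (hw_std x hcl hA hz).eq_of_nhds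
        rw [hwstd] at hwx
        unfold wstd bowl at hwx
        rw [hz5, hlam, hδ₀] at hwx
        have : (5 * s / 4 - (s / 2 - s / 8 + s / 8 * hsq x)) / s ≤ 4 * (1 / 16) := by linarith
        rw [div_le_iff₀ hs] at this
        have hh2 : hsq x < 2 := lt_of_lt_of_le hlt (by nlinarith)
        have hprod : s * hsq x < s * 2 := mul_lt_mul_of_pos_left hh2 hs
        linarith
      · -- the lateral face
        have := fillFun_pos_of_lateral hP hN hS heq (by linarith) (by linarith)
        exact absurd hA (not_le.2 this)
  -- HB2, HG2
  have HB2 : ∀ x, FB x ≤ 0 → w x ≤ 1 + 3 * δ₀ → fderiv ℝ w x ≠ 0 := fun x hx _ => core_B2 x hx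
  have HG2 : ∀ x ∈ G₀, F₂ x ≤ 0 → w x ≤ 1 + 3 * δ₀ → fderiv ℝ w x ≠ 0 := by
    intro x hxG hA _
    by_cases hB : FB x ≤ 0
    · exact core_B2 x hB
    · push Not at hB
      have hxR := hRexp_of x (subset_closure hxG) hA hB
      rw [(hw_std x (subset_closure hxG) hA hxR.2.1).fderiv_eq]
      exact fderiv_wstd_ne_zero s lam hs0.ne' x
  -- HB3, Hprop
  have HB3 : ∀ x, FB x = 0 → x ∉ G₀ → w x ≤ 1 + 3 * δ₀ → ∀ c : ℝ, 0 ≤ c → fderiv ℝ w x ≠ c • fderiv ℝ FB x :=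
    fun x hx _ hwx c hc => core_B3 x hx hwx c hc
  have Hprop : ∀ x, FB x = 0 → F₂ x = 0 → x ∉ G₀ → w x ≤ 1 + 3 * δ₀ →
      ∃ μ : ℝ, 0 < μ ∧ fderiv ℝ F₂ x = μ • fderiv ℝ FB x := fun x hx _ hxG _ => hshared_D x hx hxG
  -- a zero of `F₂` in `B` is on `W`
  have hFB0_of : ∀ x, F₂ x = 0 → FB x ≤ 0 → FB x = 0 := by
    intro x hx hB
    rcases hB.lt_or_eq with hlt | heq
    · exfalso
      refine not_eventually_nonpos hP hN hS hx ?_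
      filter_upwards [(isOpen_lt hFBc continuous_const).mem_nhds hlt] with y hy using hBsub y (le_of_lt hy)
    · exact heq
  -- HG3
  have HG3 : ∀ x ∈ G₀, F₂ x = 0 → w x ≤ 1 + 3 * δ₀ → ∀ c : ℝ, 0 ≤ c → fderiv ℝ w x ≠ c • fderiv ℝ F₂ x := by
    intro x hxG hx0 hwx c hc
    have hxB : x ∈ closedBox s := by
      obtain ⟨h1, h2, h3⟩ := hxG
      exact ⟨by nlinarith, by linarith, by linarith⟩
    by_cases hz : -(3 * s / 8) < x 2
    · -- explicit region: the horizontal radial derivative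
      rw [(hw_std x (subset_closure hxG) hx0.le hz).fderiv_eq]
      intro h
      obtain ⟨u, hu0, hu1, hu2⟩ := exists_horizontal x
      have hpos := fderiv_fillFun_horizontal_pos hP hN hS hxB hx0 hu0 hu1 hu2
      have h1 := congrArg (fun L : EuclideanSpace ℝ (Fin 3) →L[ℝ] ℝ => L u) h
      simp only [fderiv_wstd, FunLike.coe_smul, Pi.smul_apply, _root_.sub_apply, dz_apply, hu2,
        dhsq_apply, hu0, hu1, smul_eq_mul] at h1
      have hh : 1 ≤ hsq x := one_le_hsq_of_fillFun_eq_zero hP hN hS hx0 hxB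
      have hh' : hsq x = x 0 * x 0 + x 1 * x 1 := by simp [hsq, sq]
      have hcpos : 0 ≤ c * fderiv ℝ F₂ x u := mul_nonneg hc hpos.le
      have hQ : 0 < 2 * x 0 * x 0 + 2 * x 1 * x 1 := by nlinarith
      have hQ' : 0 < s⁻¹ * (lam * (2 * x 0 * x 0 + 2 * x 1 * x 1)) :=
        mul_pos (inv_pos.2 hs0) (mul_pos hlam0 hQ)
      have heq : s⁻¹ * (0 - lam * (2 * x 0 * x 0 + 2 * x 1 * x 1)) =
          -(s⁻¹ * (lam * (2 * x 0 * x 0 + 2 * x 1 * x 1))) := by ring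
      linarith
    · -- low point: in `B`, hence on `W`, a rim point: reduce to the conormal condition for `F_B`
      push Not at hz
      have hLZ : x ∈ lidZone s := hG₀LZ (subset_closure hxG)
      have hB : FB x ≤ 0 := FB_nonpos_of_low hP hN hS hface hLZ.1 hLZ.2.1 hz hx0.le
      have hb : FB x = 0 := hFB0_of x hx0 hB
      -- `subFun = lidFun = F₂` near `x`
      have hxW : x ∈ W := (hFBW x).1 hb
      rw [hW, subSphere_eq hP hN hS] at hxW
      have hG : lidFun P s x = 0 := by
        rcases hxW with (⟨hG, -⟩ | ⟨-, hz5, -⟩) | ⟨-, hxB'⟩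
        · exact hG
        · exfalso; linarith [hxG.2.1]
        · exact absurd hxB hxB'
      have hh := hsq_ge_of_lidFun_eq_zero hP hS hG hz (by linarith [hxG.2.1])
      have hev : subFun F P s δ M₀ =ᶠ[𝓝 x] F₂ := by
        -- both equal the lid function near `x`
        have hO : IsOpen {y : EuclideanSpace ℝ (Fin 3) | y ∈ lidZone s ∧ -3 * s < y 2 ∧ lidFun P s y < F y - δ} :=
          (isOpen_lidZone s).inter ((isOpen_lt continuous_const (continuous_coord 2)).inter
            (isOpen_lt (contDiff_lidFun hP.hP).continuous (hN.hF.continuous.sub continuous_const)))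
        have hxO : x ∈ {y : EuclideanSpace ℝ (Fin 3) | y ∈ lidZone s ∧ -3 * s < y 2 ∧ lidFun P s y < F y - δ} := by
          refine ⟨hLZ, by linarith [hxG.2.1], ?_⟩
          rw [hG, F_eq hN hS hLZ.1.le (abs_le.2 ⟨by linarith [hxG.2.1], by linarith [hxG.2.2]⟩)]
          nlinarith
        filter_upwards [hO.mem_nhds hxO] with y hy
        obtain ⟨⟨hy1, hy2, hy3⟩, hy4, hy5⟩ := hy
        rw [subFun_eq_lidFun hs hy1.le hy2.le hy3.le]
        exact (fillFun_eq_lid hP hS hy1.le (by linarith) (by linarith) hy5.le).symm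
      obtain ⟨μ, hμ, hD⟩ := hco x ((hFBW x).1 hb)
      rw [hev.fderiv_eq] at hD
      intro h
      have : fderiv ℝ w x = (c * μ⁻¹) • fderiv ℝ FB x := by
        rw [h, hD, smul_smul, mul_assoc, inv_mul_cancel₀ hμ.ne', mul_one]
      exact core_B3 x hb hwx (c * μ⁻¹) (by positivity) this
  -- the remaining value facts
  have hbowl_ge : ∀ x : EuclideanSpace ℝ (Fin 3), 3 * s / 8 ≤ bowl s lam x := fun x => by
    unfold bowl; rw [hlam]; nlinarith [hsq_nonneg x]
  have W1 : ∀ b, FB b = 0 → b ∉ closedBox s → w b < 1 := by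
    intro b hb hbB
    obtain ⟨y, L, hyb, hΨy, hΨinvb, -, hy1, -, -⟩ := hΨdata b hb.le
    have hy := hy1 hb
    have hwb : w b = H y := by rw [(hw_B b hb.le).eq_of_nhds, hΨinvb]
    have hym : y 2 < m := by
      by_contra hge; push Not at hge
      have hΨy' : Ψ y = ΦM y := hΨagree' y (mem_ball_zero_iff.1 hyb) hge
      have hzM : FM P s b = 0 := by
        have : b ∈ ΦM '' sphere 0 1 := ⟨y, mem_sphere_zero_iff_norm.2 hy, by rw [← hΨy', hΨy]⟩
        rw [hΦMS] at this; exact this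
      obtain ⟨habs, hh, -⟩ := ModelSweep.bounds_of_FM_nonpos hP hs hzM.le
      exact hbB ⟨by nlinarith, by linarith [(abs_le.1 habs).1], by linarith [(abs_le.1 habs).2]⟩
    have hheight : (ΦM y) 2 < -(s / 2) + 3 * m := by
      rw [hΦM, ModelSweep.rmap_apply_two]
      obtain ⟨hl, hu⟩ := ModelSweep.factor_mem hP hs hs1 y
      set μ := RadialBallMap.factor (prof P s) (s / 8) y
      rcases le_or_gt (y 2) 0 with h0 | h0
      · have : μ * y 2 ≤ 0 := mul_nonpos_of_nonneg_of_nonpos (by linarith) h0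
        linarith
      · have : μ * y 2 ≤ 3 * y 2 := by nlinarith
        nlinarith
    rw [hwb]
    show wstd s lam s (ΦM y) < 1
    unfold wstd
    have hb1 := hbowl_ge (ΦM y)
    have : ((ΦM y) 2 - bowl s lam (ΦM y)) / s < 0 := by
      apply div_neg_of_neg_of_pos _ hs0
      rw [hm] at hheight; linarith
    linarith
  have W2 : ∀ x, FB x ≤ 0 → 3 / 4 ≤ w x → (w =ᶠ[𝓝 x] wstd s lam s) ∧ FM P s x ≤ 0 := by
    intro x hx hwx
    obtain ⟨y, L, hyb, hΨy, hΨinvx, hy1, -, -, -⟩ := hΨdata x hx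
    have hwx' : w x = H y := by rw [(hw_B x hx).eq_of_nhds, hΨinvx]
    rw [hwx'] at hwx
    have hFMy : FM P s (ΦM y) ≤ 0 := by
      have : ΦM y ∈ ΦM '' closedBall 0 1 := ⟨y, mem_closedBall_zero_iff.2 hy1, rfl⟩
      rw [hΦMD] at this; exact this
    -- the height of `Φ_M y`
    have hhy : s / 8 ≤ (ΦM y) 2 := by
      change 3 / 4 ≤ wstd s lam s (ΦM y) at hwx
      unfold wstd at hwx
      have hb1 := hbowl_ge (ΦM y)
      have : -(1 / 4) ≤ ((ΦM y) 2 - bowl s lam (ΦM y)) / s := by linarith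
      rw [le_div_iff₀ hs0] at this
      linarith
    have hym : m ≤ y 2 := by
      have hz : -(s / 2) + 5 * s / 8 ≤ (RadialBallMap.rmap (p0 s) (prof P s) (s / 8) y) 2 := by
        rw [← hΦM]; linarith
      have := ModelSweep.zone_of_height' hP hs hs1 (by positivity) hz
      rw [hm]; linarith
    have hxy : x = ΦM y := by rw [← hΨy]; exact hΨagree' y (mem_ball_zero_iff.1 hyb) hym
    have hFMx : FM P s x ≤ 0 := by rw [hxy]; exact hFMy
    refine ⟨?_, hFMx⟩
    have hxV : x ∈ Vz := hM_Vz x hFMx (by rw [hxy]; linarith)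
    have hxN : x ∈ N₀ := hK₀N (Or.inl hx)
    filter_upwards [(hN₀o.inter hVzo).mem_nhds ⟨hxN, hxV⟩] with y' hy'
    rw [hw₁ y' ⟨hy'.1, hVzΩ₁ hy'.2⟩]
    exact hVz_std y' hy'.2
  have W4 : ∀ x, x ∈ closure G₀ → F₂ x ≤ 0 → 0 < FB x → -(3 * s / 8) < x 2 :=
    fun x hcl hA hpos => (hRexp_of x hcl hA hpos).2.1
  exact ⟨w, hws, Hagree, Hbdry, HB2, HG2, HB3, Hprop, HG3, W1, W2, hw_std, W4⟩

set_option maxHeartbeats 1600000 in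
/-- **The absorption of the ball `B` of the capped-ball step** (Schultens (2014), Lemma 3.2.3
applied in the proof of Thm. 3.2.5, PDF p. 45).  Under the hypotheses of `exists_sweepFunction`
there are a smooth function `F_U ≥ F₂`, regular on its zero set, and a diffeomorphism `Φ` of
`ℝ³` with `Φ({F₂ ≤ 0}) = {F_U ≤ 0}` and `Φ({F₂ = 0}) = {F_U = 0}`, such that: near every zero of
`F₂` off the closed box and off `E₂`, `Φ = id` and `F_U = F₂`; every horizontal point of `F_U` on
its zero set is either such a far zero of `F₂` (with `F_U = F₂` nearby) or the bowl centre
`p_c = (0, 0, 3s/8)`, which is a zero of `F_U` near which `F_U = (z_b - x₂)/s`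
(`z_b = 3s/8 + (s/8)ρ²`); and the zeros of `F_U` at height `0` are exactly the zeros of `F₂` at
height `0` off the closed box and off `E₂`.
[cite: Schultens2014, Lemma 3.2.3 and proof of Thm. 3.2.5 (PDF pp. 42–45)] -/
theorem exists_sweepStep (hP : Admissible P) (hN : StepNF F E₁ E₂ w₀ η₀ ε₀) (hS : StepScale s δ w₀ η₀)
    {FB : EuclideanSpace ℝ (Fin 3) → ℝ} (hFBs : ContDiff ℝ ∞ FB)
    (hFBW : ∀ x, FB x = 0 ↔ x ∈ subSphere F P E₁ s δ ε₀)
    (hFBreg : ∀ x, FB x = 0 → fderiv ℝ FB x ≠ 0)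
    (hBsub : ∀ x, FB x ≤ 0 → fillFun F P s δ ((1 + s) ^ 2 + ε₀ + 2) x ≤ 0)
    (hco : ∀ x ∈ subSphere F P E₁ s δ ε₀, ∃ μ : ℝ, 0 < μ ∧
      fderiv ℝ FB x = μ • fderiv ℝ (subFun F P s δ ((1 + s) ^ 2 + ε₀ + 2)) x)
    (hface : StdFace FB P s)
    (ΦB : EuclideanSpace ℝ (Fin 3) ≃ₘ⟮𝓘(ℝ, EuclideanSpace ℝ (Fin 3)), 𝓘(ℝ, EuclideanSpace ℝ (Fin 3))⟯
      EuclideanSpace ℝ (Fin 3))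
    (hΦBD : ΦB '' closedBall 0 1 = {x | FB x ≤ 0}) (hΦBS : ΦB '' sphere 0 1 = {x | FB x = 0})
    (hΦBo : ΦB '' ball 0 1 = {x | FB x < 0})
    {ε₁ : ℝ} (hε₁ : 0 < ε₁) (hK₁ : IsCompact {x | fillFun F P s δ ((1 + s) ^ 2 + ε₀ + 2) x ≤ ε₁}) :
    ∃ (FU : EuclideanSpace ℝ (Fin 3) → ℝ)
      (Φ : EuclideanSpace ℝ (Fin 3) ≃ₘ⟮𝓘(ℝ, EuclideanSpace ℝ (Fin 3)), 𝓘(ℝ, EuclideanSpace ℝ (Fin 3))⟯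
        EuclideanSpace ℝ (Fin 3)),
      ContDiff ℝ ∞ FU ∧
      Φ '' {x | fillFun F P s δ ((1 + s) ^ 2 + ε₀ + 2) x ≤ 0} = {x | FU x ≤ 0} ∧
      Φ '' {x | fillFun F P s δ ((1 + s) ^ 2 + ε₀ + 2) x = 0} = {x | FU x = 0} ∧
      (∀ x, FU x = 0 → fderiv ℝ FU x ≠ 0) ∧
      (∀ x, fillFun F P s δ ((1 + s) ^ 2 + ε₀ + 2) x ≤ FU x) ∧
      (∀ p, fillFun F P s δ ((1 + s) ^ 2 + ε₀ + 2) p = 0 → p ∉ closedBox s → p ∉ E₂ →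
        (∀ᶠ x in 𝓝 p, Φ x = x) ∧ FU =ᶠ[𝓝 p] fillFun F P s δ ((1 + s) ^ 2 + ε₀ + 2)) ∧
      (∀ x, FU x = 0 → (∃ c : ℝ, fderiv ℝ FU x = c • dz) →
        (fillFun F P s δ ((1 + s) ^ 2 + ε₀ + 2) x = 0 ∧ x ∉ closedBox s ∧ x ∉ E₂ ∧
          FU =ᶠ[𝓝 x] fillFun F P s δ ((1 + s) ^ 2 + ε₀ + 2)) ∨
        x = EuclideanSpace.single (2 : Fin 3) (3 * s / 8)) ∧
      FU (EuclideanSpace.single (2 : Fin 3) (3 * s / 8)) = 0 ∧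
      (FU =ᶠ[𝓝 (EuclideanSpace.single (2 : Fin 3) (3 * s / 8))] fun x => (bowl s (s / 8) x - x 2) / s) ∧
      {x | FU x = 0 ∧ x 2 = 0} =
        {x | fillFun F P s δ ((1 + s) ^ 2 + ε₀ + 2) x = 0 ∧ x 2 = 0 ∧ x ∉ closedBox s ∧ x ∉ E₂} := by
  obtain ⟨hs, hs1, hsw, hsη, hδ, hδs⟩ := scales hS
  set M₀ : ℝ := (1 + s) ^ 2 + ε₀ + 2 with hM₀
  set F₂ : EuclideanSpace ℝ (Fin 3) → ℝ := fillFun F P s δ M₀ with hF₂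
  set W : Set (EuclideanSpace ℝ (Fin 3)) := subSphere F P E₁ s δ ε₀ with hW
  have hPd := hP.differentiable
  have hε₀ := hN.hε₀
  have hF₂s : ContDiff ℝ ∞ F₂ := contDiff_fillFun hN.hF hP.hP
  have hF₂c : Continuous F₂ := hF₂s.continuous
  have hFBc : Continuous FB := hFBs.continuous
  have hreg₂ : ∀ x, F₂ x = 0 → fderiv ℝ F₂ x ≠ 0 := fun x hx =>
    fderiv_fillFun_ne_zero hP.hP hP.hP0 hP.hPd hP.hPge hP.hPle hN.hF hε₀ hN.hreg hs hs1 hsw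
      (by linarith) hN.hNFa hN.hNFb hδ (by linarith) hx
  set G₀ : Set (EuclideanSpace ℝ (Fin 3)) :=
    {x | hsq x < (1 + 3 * s / 2) ^ 2 ∧ -(9 * s / 4) < x 2 ∧ x 2 < 5 * s / 4} with hG₀
  have hG₀o : IsOpen G₀ := (isOpen_lt continuous_hsq continuous_const).inter
    ((isOpen_lt continuous_const (continuous_coord 2)).inter (isOpen_lt (continuous_coord 2) continuous_const))
  have hG₀B : G₀ ⊆ closedBox s := fun x ⟨h1, h2, h3⟩ => ⟨by nlinarith, by linarith, by linarith⟩
  set pc : EuclideanSpace ℝ (Fin 3) := EuclideanSpace.single (2 : Fin 3) (3 * s / 8) with hpc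
  have hpc2 : pc 2 = 3 * s / 8 := by simp [hpc]
  have hpc0 : pc 0 = 0 := by simp [hpc]
  have hpc1 : pc 1 = 0 := by simp [hpc]
  have hpch : hsq pc = 0 := by simp [hsq, hpc0, hpc1]
  -- the sweep function and the sweep
  obtain ⟨w, hws, Hagree, Hbdry, HB2, HG2, HB3, Hprop, HG3, W1, W2, W3, W4⟩ :=
    exists_sweepFunction hP hN hS hFBs hFBW hFBreg hBsub hco hface ΦB hΦBD hΦBS hΦBo hε₁ hK₁
  obtain ⟨wt, T, δsw, Φ, hwts, hTo, hBT, hGT, hwtT, -, hsmall, hδsw0, hδswle, himg, himg0, hΦid, hregU,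
      hUsub, hFU_far, hFU_bowl⟩ :=
    SweepTransfer.exists_sweep hP.hP hP.hP0 hP.hP1 hP.hPd hP.hPge hP.hPle hF₂s hFBs hws hε₁ hK₁ hreg₂ hBsub
      hG₀o (by norm_num : (0 : ℝ) < 1 / 16) Hagree Hbdry HB2 HG2 HB3 Hprop HG3 (le_refl (1 + 6 * (1 / 16 : ℝ)))
      isClosed_empty (Set.empty_disjoint _) (Set.empty_disjoint _)
  set FU : EuclideanSpace ℝ (Fin 3) → ℝ := fun x => F₂ x + δsw * P ((1 - wt x - F₂ x) / δsw) with hFU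
  -- smoothness, comparison, derivative
  have hFUs : ContDiff ℝ ∞ FU := by
    refine hF₂s.add (contDiff_const.mul (hP.hP.comp ?_))
    exact ((contDiff_const.sub hwts).sub hF₂s).div_const _
  have hF₂le : ∀ x, F₂ x ≤ FU x := fun x => by
    have h0 : 0 ≤ P ((1 - wt x - F₂ x) / δsw) := le_trans (le_max_left _ _) (hP.hPge _)
    show F₂ x ≤ F₂ x + δsw * P ((1 - wt x - F₂ x) / δsw)
    nlinarith
  have hDFU : ∀ x, fderiv ℝ FU x =
      (1 - deriv P ((1 - wt x - F₂ x) / δsw)) • fderiv ℝ F₂ x +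
        deriv P ((1 - wt x - F₂ x) / δsw) • (-fderiv ℝ wt x) := by
    intro x
    have hF : HasFDerivAt F₂ (fderiv ℝ F₂ x) x := ((hF₂s.differentiable (by simp)) x).hasFDerivAt
    have hℓ : HasFDerivAt (fun y => 1 - wt y) (-fderiv ℝ wt x) x := by
      have := ((hwts.differentiable (by simp)) x).hasFDerivAt.const_sub 1
      simpa using this
    exact (SmoothMax.hasFDerivAt_smax hPd hδsw0.ne' hF hℓ).fderiv
  -- `wt = w` near points of `T`
  have hwt_w : ∀ x ∈ T, wt =ᶠ[𝓝 x] w := fun x hx => by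
    filter_upwards [hTo.mem_nhds hx] with y hy using hwtT y hy
  -- zeros of `F₂` in `B` are on `W`; far zeros are not in `B`
  have hFB0_of : ∀ x, F₂ x = 0 → FB x ≤ 0 → FB x = 0 := by
    intro x hx hB
    rcases hB.lt_or_eq with hlt | heq
    · exfalso
      refine not_eventually_nonpos hP hN hS hx ?_
      filter_upwards [(isOpen_lt hFBc continuous_const).mem_nhds hlt] with y hy using hBsub y (le_of_lt hy)
    · exact heq
  have hW_far : ∀ p, FB p = 0 → p ∉ closedBox s → p ∈ E₂ := by
    intro p hp hpB
    have hpW : p ∈ W := (hFBW p).1 hp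
    rw [hW, subSphere_eq hP hN hS] at hpW
    rcases hpW with (⟨hG, hz3⟩ | ⟨-, -, hpB'⟩) | ⟨hE₂, -⟩
    · exfalso
      obtain ⟨hzs, hhsq⟩ := bounds_of_lidFun_eq_zero hP hS hG
      exact hpB ⟨by nlinarith, by linarith, by linarith⟩
    · exact absurd hpB' hpB
    · exact hE₂
  have hwt_far : ∀ p, F₂ p = 0 → p ∉ closedBox s → p ∉ E₂ → 1 + 3 * (1 / 16) < wt p := by
    intro p hp hpB hpE
    by_contra hle
    push Not at hle
    obtain ⟨-, hBG⟩ := hsmall p hp.le hle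
    rcases hBG with hB | hG
    · exact hpE (hW_far p (hFB0_of p hp hB) hpB)
    · exact hpB (hG₀B hG)
  have hfar : ∀ p, F₂ p = 0 → p ∉ closedBox s → p ∉ E₂ → (∀ᶠ x in 𝓝 p, Φ x = x) ∧ FU =ᶠ[𝓝 p] F₂ := by
    intro p hp hpB hpE
    have hwtp := hwt_far p hp hpB hpE
    have hopen : IsOpen {x | 1 + δsw < wt x + F₂ x} := isOpen_lt continuous_const (hwts.continuous.add hF₂c)
    have hmem : p ∈ {x | 1 + δsw < wt x + F₂ x} := by
      show 1 + δsw < wt p + F₂ p; rw [hp]; linarith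
    refine ⟨?_, ?_⟩
    · filter_upwards [hopen.mem_nhds hmem] with x hx using hΦid x (le_of_lt hx)
    · filter_upwards [hopen.mem_nhds hmem] with x hx using hFU_far x (le_of_lt hx)
  -- where `wt` is small on `A₁` it is the standard sweep function nearby
  have hstd : ∀ x, F₂ x ≤ 0 → 1 ≤ wt x → wt x ≤ 1 + 3 * (1 / 16) →
      (wt =ᶠ[𝓝 x] wstd s (s / 8) s) ∧ (FB x ≤ 0 → FM P s x ≤ 0) := by
    intro x hA hwt1 hwt2
    obtain ⟨hxT, hBG⟩ := hsmall x hA hwt2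
    have hwx : w x = wt x := (hwtT x hxT).symm
    by_cases hB : FB x ≤ 0
    · obtain ⟨hw, hFM⟩ := W2 x hB (by rw [hwx]; linarith)
      exact ⟨(hwt_w x hxT).trans hw, fun _ => hFM⟩
    · push Not at hB
      have hxG : x ∈ G₀ := by
        rcases hBG with h | h
        · exact absurd h (not_le.2 hB)
        · exact h
      have hz := W4 x (subset_closure hxG) hA hB
      exact ⟨(hwt_w x hxT).trans (W3 x (subset_closure hxG) hA hz), fun h => absurd h (not_le.2 hB)⟩
  have hx2_of_std : ∀ x, wt x = wstd s (s / 8) s x → x 2 = 3 * s / 8 + s / 8 * hsq x + s * (wt x - 1) := by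
    intro x h
    unfold wstd bowl at h
    have : (x 2 - (s / 2 - s / 8 + s / 8 * hsq x)) / s = wt x - 1 := by linarith
    rw [div_eq_iff hs.ne'] at this
    linarith
  -- model points above the bowl are inside radius `√(5/8)`
  have hM_hsq : ∀ x, FM P s x ≤ 0 → 3 * s / 8 ≤ x 2 → hsq x ≤ 5 / 8 := by
    intro x hx hz
    have h1 := (FM_bounds hP.hPge hP.hPle hs x (P := P)).1
    have h2 := (lid'_bounds hP.hPge hP.hPle hs x (P := P)).1
    have htop : topFun s x ≤ 0 := (le_max_left _ _).trans (h2.trans ((le_max_left _ _).trans (h1.trans hx)))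
    unfold topFun at htop
    nlinarith
  -- the bowl centre
  have hpcM : FM P s pc < 0 := FM_axis_neg hP hs hs1 hpch (by rw [hpc2]; linarith) (by rw [hpc2]; linarith)
  have hpcB : FB pc < 0 := ModelSweep.FB_neg_of_FM_neg hP hs hface hpcM
  have hpcA : F₂ pc ≤ 0 := hBsub pc hpcB.le
  have hpcG : pc ∈ G₀ := ⟨by rw [hpch]; positivity, by rw [hpc2]; linarith, by rw [hpc2]; linarith⟩
  have hpc_std : wt =ᶠ[𝓝 pc] wstd s (s / 8) s :=
    (hwt_w pc (hBT hpcB.le)).trans (W3 pc (subset_closure hpcG) hpcA (by rw [hpc2]; linarith))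
  have hwstd_pc : wstd s (s / 8) s pc = 1 := by unfold wstd bowl; rw [hpch, hpc2]; field_simp; ring
  have hwt_pc : wt pc = 1 := by rw [hpc_std.eq_of_nhds]; exact hwstd_pc
  have hF₂pc : F₂ pc ≤ -1 := by
    have hF : F pc = hsq pc - 1 := F_eq hN hS (by rw [hpch]; positivity) (by rw [hpc2, abs_of_pos (by positivity)]; linarith)
    have := (fillFun_mem hP hS (F := F) (ε₀ := ε₀) (x := pc) (by rw [hpch]; positivity)
      (by rw [hpc2]; linarith) (by rw [hpc2]; linarith)).2
    rw [hpch] at hF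
    have hle : F₂ pc ≤ F pc := this.trans (min_le_left _ _)
    linarith
  have hpc_bowl : FU =ᶠ[𝓝 pc] fun x => (bowl s (s / 8) x - x 2) / s := by
    have hopen : IsOpen {x | F₂ x + wt x < 1 - δsw} := isOpen_lt (hF₂c.add hwts.continuous) continuous_const
    have hmem : pc ∈ {x | F₂ x + wt x < 1 - δsw} := by
      show F₂ pc + wt pc < 1 - δsw; rw [hwt_pc]; linarith
    filter_upwards [hopen.mem_nhds hmem, hpc_std] with x hx hxw
    show F₂ x + δsw * P ((1 - wt x - F₂ x) / δsw) = (bowl s (s / 8) x - x 2) / s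
    rw [hFU_bowl x (le_of_lt hx), hxw]
    unfold wstd; ring
  have hFUpc : FU pc = 0 := by
    rw [hpc_bowl.eq_of_nhds]; simp only [bowl, hpch, hpc2]; ring
  -- the case analysis on `t = (1 - wt - F₂)/δ`
  have ht_cases : ∀ x, FU x = 0 →
      (1 + δsw ≤ wt x + F₂ x ∧ F₂ x = 0 ∧ fderiv ℝ FU x = fderiv ℝ F₂ x) ∨
      (F₂ x + wt x ≤ 1 - δsw ∧ wt x = 1 ∧ fderiv ℝ FU x = -fderiv ℝ wt x) ∨
      (-(2 * δsw) < F₂ x ∧ F₂ x ≤ 0 ∧ 1 ≤ wt x ∧ wt x < 1 + 3 * δsw) := by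
    intro x hx
    obtain ⟨hA, hwt1⟩ := hUsub x hx.le
    set t : ℝ := (1 - wt x - F₂ x) / δsw with ht
    by_cases ht1 : t ≤ -1
    · left
      have hsum : 1 + δsw ≤ wt x + F₂ x := by
        rw [ht, div_le_iff₀ hδsw0] at ht1; linarith
      have hFUx : FU x = F₂ x := hFU_far x hsum
      refine ⟨hsum, by rw [← hFUx]; exact hx, ?_⟩
      rw [hDFU x, SmoothMax.deriv_eq_zero_of_le hP.hP0 hP.hPge ht1]
      simp
    by_cases ht2 : 1 ≤ t
    · right; left
      have hsum : F₂ x + wt x ≤ 1 - δsw := by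
        rw [ht, le_div_iff₀ hδsw0] at ht2; linarith
      have hFUx : FU x = 1 - wt x := hFU_bowl x hsum
      refine ⟨hsum, by rw [hFUx] at hx; linarith, ?_⟩
      rw [hDFU x, SmoothMax.deriv_eq_one_of_le hPd hP.hP1 hP.hPge ht2]
      simp
    · right; right
      push Not at ht1 ht2
      have hge := hP.hPge t
      have hle := hP.hPle t
      have hx' : F₂ x + δsw * P t = 0 := hx
      have hmax1 : max 0 t < 1 := max_lt one_pos ht2
      have hmax0 : 0 ≤ max 0 t := le_max_left _ _
      have htdef : δsw * t = 1 - wt x - F₂ x := by rw [ht]; field_simp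
      refine ⟨?_, hA, hwt1, ?_⟩
      · nlinarith
      · nlinarith
  -- axis points: `-Dw_std(x) = c dz` forces `x₀ = x₁ = 0`
  have haxis : ∀ x (c : ℝ), -fderiv ℝ (wstd s (s / 8) s) x = c • dz → x 0 = 0 ∧ x 1 = 0 := by
    intro x c h
    rw [fderiv_wstd] at h
    have happ : ∀ v : EuclideanSpace ℝ (Fin 3), v 2 = 0 →
        s⁻¹ * (s / 8) * (2 * x 0 * v 0 + 2 * x 1 * v 1) = 0 := by
      intro v hv
      have := congrArg (fun L : EuclideanSpace ℝ (Fin 3) →L[ℝ] ℝ => L v) h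
      simp only [neg_apply, FunLike.coe_smul, Pi.smul_apply, _root_.sub_apply, smul_eq_mul, dz_apply,
        dhsq_apply, hv, mul_zero] at this
      linarith
    have hs8 : s⁻¹ * (s / 8) = 1 / 8 := by field_simp
    have h0 := happ (EuclideanSpace.single 0 1) (by simp)
    have h1 := happ (EuclideanSpace.single 1 1) (by simp)
    rw [hs8] at h0 h1
    have e00 : (EuclideanSpace.single (0 : Fin 3) (1 : ℝ) : EuclideanSpace ℝ (Fin 3)) 0 = 1 := by simp
    have e01 : (EuclideanSpace.single (0 : Fin 3) (1 : ℝ) : EuclideanSpace ℝ (Fin 3)) 1 = 0 := by simp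
    have e10 : (EuclideanSpace.single (1 : Fin 3) (1 : ℝ) : EuclideanSpace ℝ (Fin 3)) 0 = 0 := by simp
    have e11 : (EuclideanSpace.single (1 : Fin 3) (1 : ℝ) : EuclideanSpace ℝ (Fin 3)) 1 = 1 := by simp
    rw [e00, e01] at h0
    rw [e10, e11] at h1
    constructor <;> linarith
  -- horizontal points
  have hhor : ∀ x, FU x = 0 → (∃ c : ℝ, fderiv ℝ FU x = c • dz) →
      (F₂ x = 0 ∧ x ∉ closedBox s ∧ x ∉ E₂ ∧ FU =ᶠ[𝓝 x] F₂) ∨ x = pc := by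
    rintro x hx ⟨c, hc⟩
    obtain ⟨hA, hwt1⟩ := hUsub x hx.le
    rcases ht_cases x hx with ⟨hsum, hF₂0, hD⟩ | ⟨hsum, hwt, hD⟩ | ⟨hF₂lb, -, -, hwtub⟩
    · -- far point
      left
      have hxB : x ∉ closedBox s := by
        intro hxB
        refine fderiv_fillFun_ne_smul hP hN hS hxB hF₂0 c ?_
        rw [← hD, hc, innerSL_single_two]; rfl
      have hxE : x ∉ E₂ := by
        intro hE
        have hxW : x ∈ W := by
          rw [hW, subSphere_eq hP hN hS]; exact Or.inr ⟨hE, hxB⟩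
        have hb : FB x = 0 := (hFBW x).2 hxW
        have hxT : x ∈ T := hBT hb.le
        have := W1 x hb hxB
        rw [← hwtT x hxT] at this
        linarith
      exact ⟨hF₂0, hxB, hxE, (hfar x hF₂0 hxB hxE).2⟩
    · -- the bowl centre
      right
      obtain ⟨hstdx, -⟩ := hstd x hA hwt1 (by rw [hwt]; norm_num)
      have hDwt : fderiv ℝ wt x = fderiv ℝ (wstd s (s / 8) s) x := hstdx.fderiv_eq
      rw [hD, hDwt] at hc
      obtain ⟨h0, h1⟩ := haxis x c hc
      have hh : hsq x = 0 := (hsq_eq_zero_iff x).2 ⟨h0, h1⟩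
      have hx2 := hx2_of_std x (hstdx.eq_of_nhds)
      rw [hh, hwt] at hx2
      ext i
      fin_cases i
      · simp [hpc, h0]
      · simp [hpc, h1]
      · simp [hpc]; linarith
    · -- the blend: impossible
      exfalso
      have hwt316 : wt x ≤ 1 + 3 * (1 / 16) := by linarith
      obtain ⟨hstdx, hFMx⟩ := hstd x hA hwt1 hwt316
      have hx2 := hx2_of_std x hstdx.eq_of_nhds
      by_cases hB : FB x ≤ 0
      · -- a model point above the bowl: deep inside `A₁`
        have hFM := hFMx hB
        have hh := hM_hsq x hFM (by nlinarith [hsq_nonneg x])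
        obtain ⟨habs, hh2, -⟩ := ModelSweep.bounds_of_FM_nonpos hP hs hFM
        have hF : F x = hsq x - 1 := F_eq hN hS (by nlinarith) (le_trans habs (by linarith))
        have hF₂F : F₂ x ≤ F x :=
          (fillFun_mem hP hS (F := F) (ε₀ := ε₀) (x := x) (by nlinarith) (by linarith [(abs_le.1 habs).1])
            (by linarith [(abs_le.1 habs).2])).2.trans (min_le_left _ _)
        linarith
      · push Not at hB
        obtain ⟨hxT, hBG⟩ := hsmall x hA hwt316
        have hxG : x ∈ G₀ := by
          rcases hBG with h | h
          · exact absurd h (not_le.2 hB)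
          · exact h
        obtain ⟨hg1, hg2, hg3⟩ := hxG
        obtain ⟨u, hu0, hu1, hu2⟩ := exists_horizontal x
        obtain ⟨K, hK, hDF₂u⟩ := fderiv_fillFun_horizontal hP hN hS (by nlinarith) (by linarith) (by linarith) hu0 hu1 hu2
        have hDwt : fderiv ℝ wt x = fderiv ℝ (wstd s (s / 8) s) x := hstdx.fderiv_eq
        have h1 := congrArg (fun L : EuclideanSpace ℝ (Fin 3) →L[ℝ] ℝ => L u) hc
        rw [hDFU x, hDwt] at h1
        simp only [_root_.add_apply, FunLike.coe_smul, Pi.smul_apply, smul_eq_mul, neg_apply,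
          fderiv_wstd, _root_.sub_apply, dz_apply, hu2, dhsq_apply, hu0, hu1, mul_zero] at h1
        have hF₂u : fderiv ℝ F₂ x u = K * hsq x := hDF₂u
        rw [hF₂u] at h1
        set θ := deriv P ((1 - wt x - F₂ x) / δsw) with hθ
        obtain ⟨hθ0, hθ1⟩ := hP.hPd ((1 - wt x - F₂ x) / δsw)
        have hh' : hsq x = x 0 * x 0 + x 1 * x 1 := by simp [hsq, sq]
        have hcalc : s⁻¹ * (0 - s / 8 * (2 * x 0 * x 0 + 2 * x 1 * x 1)) = -(hsq x / 4) := by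
          rw [hh']; field_simp; ring
        rw [hcalc] at h1
        -- `h1 : (1 - θ) K ρ² + θ ρ²/4 = 0`
        have key : hsq x * ((1 - θ) * K + θ / 4) = 0 := by linear_combination h1
        have hbr : 2 * s ≤ (1 - θ) * K + θ / 4 := by
          nlinarith [mul_le_mul_of_nonneg_left hK (sub_nonneg.2 hθ1)]
        have hsq0 : hsq x = 0 := by
          rcases mul_eq_zero.1 key with h | h
          · exact h
          · exfalso; linarith
        -- an axis point at height in `[3s/8, 9s/16]`: inside the model, contradiction
        have hz1 : 3 * s / 8 ≤ x 2 := by rw [hx2, hsq0]; nlinarith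
        have hz2 : x 2 < s := by rw [hx2, hsq0]; nlinarith
        have hFM := FM_axis_neg hP hs hs1 hsq0 (by linarith) hz2
        have := ModelSweep.FB_neg_of_FM_neg hP hs hface hFM
        linarith
  -- the zeros at height `0`
  have hlevel : {x | FU x = 0 ∧ x 2 = 0} = {x | F₂ x = 0 ∧ x 2 = 0 ∧ x ∉ closedBox s ∧ x ∉ E₂} := by
    ext x
    simp only [mem_setOf_eq]
    constructor
    · rintro ⟨hx, hx2⟩
      obtain ⟨hA, hwt1⟩ := hUsub x hx.le
      rcases ht_cases x hx with ⟨hsum, hF₂0, -⟩ | ⟨hsum, hwt, -⟩ | ⟨hF₂lb, -, -, hwtub⟩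
      · have hxB : x ∉ closedBox s := by
          intro hxB
          by_cases hB : FB x ≤ 0
          · have hb := hFB0_of x hF₂0 hB
            have hxT : x ∈ T := hBT hB
            obtain ⟨hw, -⟩ := W2 x hB (by rw [← hwtT x hxT]; linarith)
            have hx2' := hx2_of_std x ((hwt_w x hxT).trans hw).eq_of_nhds
            rw [hx2] at hx2'
            nlinarith [hsq_nonneg x]
          · push Not at hB
            have hh := CappedBallLid.hsq_le_of_fillFun_eq_zero' hP hN hS hF₂0 hxB
            have hxG : x ∈ G₀ := ⟨by nlinarith, by rw [hx2]; linarith, by rw [hx2]; linarith⟩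
            have hwstd := W3 x (subset_closure hxG) hA (by rw [hx2]; linarith)
            have hwx : w x < 1 + 4 * (1 / 16) := by
              rw [hwstd.eq_of_nhds]
              unfold wstd bowl; rw [hx2]
              have : (0 - (s / 2 - s / 8 + s / 8 * hsq x)) / s < 0 :=
                div_neg_of_neg_of_pos (by nlinarith [hsq_nonneg x]) hs
              linarith
            have hxT : x ∈ T := hGT ⟨hxG, hwx⟩
            have hx2' := hx2_of_std x ((hwt_w x hxT).trans hwstd).eq_of_nhds
            rw [hx2] at hx2'
            nlinarith [hsq_nonneg x]
        have hxE : x ∉ E₂ := by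
          intro hE
          have hxW : x ∈ W := by
            rw [hW, subSphere_eq hP hN hS]; exact Or.inr ⟨hE, hxB⟩
          have hb : FB x = 0 := (hFBW x).2 hxW
          have hxT : x ∈ T := hBT hb.le
          have := W1 x hb hxB
          rw [← hwtT x hxT] at this
          linarith
        exact ⟨hF₂0, hx2, hxB, hxE⟩
      · exfalso
        obtain ⟨hstdx, -⟩ := hstd x hA hwt1 (by rw [hwt]; norm_num)
        have hx2' := hx2_of_std x hstdx.eq_of_nhds
        rw [hx2, hwt] at hx2'
        nlinarith [hsq_nonneg x]
      · exfalso
        obtain ⟨hstdx, -⟩ := hstd x hA hwt1 (by linarith)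
        have hx2' := hx2_of_std x hstdx.eq_of_nhds
        rw [hx2] at hx2'
        nlinarith [hsq_nonneg x]
    · rintro ⟨hx, hx2, hxB, hxE⟩
      refine ⟨?_, hx2⟩
      rw [(hfar x hx hxB hxE).2.eq_of_nhds]; exact hx
  exact ⟨FU, Φ, hFUs, himg, himg0, hregU, hF₂le, hfar, hhor, hFUpc, hpc_bowl, hlevel⟩


end Literature.Topology.FourManifolds.SweepDriver
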